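import Literature.NumberTheory.GaloisRepresentations.HasseArfTower
import HarnessLib

/-!
# Hasse–Arf, the cyclic core: the last upper jump of a cyclic totally ramified group is integral (Serre V §7, Prop. 11), completion-free

Fourth file of the series (`HasseArfLayerTrace`, `HasseArfLayerNorm`, `HasseArfTower`).  Setting:
`R` Dedekind with fraction field `K`, `L/K` finite abelian, `S = integralClosure R L`, `𝔓 ≠ 0`
maximal with separable residue extension, `H = ⟨s⟩ ≤ T_𝔓` cyclic of order `r`, `μ` the last jump
of `H` (`H_μ ≠ 1`, `H_{μ+1} = 1`).  **Theorem** (`card_dvd_ramificationCardSum_last_jump`):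
if the residue field of `𝔓` is not the prime field, then `r ∣ S_H(μ) = Σ_{i=1}^{μ} |H_i|`, i.e.
`φ_H(μ) ∈ ℤ` — Serre's Prop. V.11, the heart of the Hasse–Arf theorem.

We follow Serre's proof (Ch. V §7, Lemmas 8–13), with three changes forced by the absence of
completions.  (1) Everything is phrased inside `S` through the cocycle relation
`c(z) = s z / z`: "`c(z) ∈ U^m`" is `s z - z ∈ 𝔓^{m + v(z)}`, "`c(z) = c(z')`" is
`s z · z' = z · s z'`, `c(z)⁻¹ = c(∏_{σ ≠ 1} σ z)`, and Serre's `W` (cocycles of units) and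
`V ⊃ W` (all cocycles, `V/W ≅ ℤ/r` by `z ↦ v(z) mod r`, Lemma 8) need no quotient groups.
(2) Serre's Lemma 12 a) (`V_m → U^m/U^{m+1}` is onto) uses an exact solution of a norm equation
(Cor. 3 to Prop. 9, by completeness); we solve it only modulo `𝔓^{rB}` (`NormFiltration.surj`)
and replace Hilbert's Theorem 90 by the explicit Lagrange resolvent together with an
**approximate independence of characters** (`mem_pow_of_forall_sum_mul_smul_mem_pow`: if
`Σ_σ a_σ σ(t) ∈ 𝔓^{N + (r-1)(μ+2)}` for all `t` then all `a_σ ∈ 𝔓^N`, by Dedekind's argument run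
with a local generator `x`, `v(σ x - x) ≤ μ + 1`), which bounds the valuation of the resolvent.
(3) Local units `u ∈ S_𝔓^×` are replaced by pairs/approximations in `S`
(`exists_sub_mul_mem_pow`).  Lemmas 9 (resolvent), 10 (`NormFiltration.inj`), 11 (scaling),
12 b) (cyclicity of `V_m/W_m` versus non-cyclicity of the residue field — this is where the
residue field must not be the prime field, Serre V §7: "we took the precaution of insuring that
`K̄` is not the prime field"), 13 (descent) and the final contradiction (`z₀ = ∏_{l<k} s^l π`,
`c(z₀) = c(s^k)(π)`, `0 < k < r`) are as in Serre.

## References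

* J.-P. Serre, *Local Fields*, GTM 67, Springer 1979: Ch. V §7, Thm 1', Prop. 11, Lemmas 8–13
  (pp. 93–96); Ch. IV §1 Lemma 1; Bourbaki, *Alg.* V §11 (Hilbert's Theorem 90, Lagrange
  resolvents). [SerreLocalFields1979]
-/

open Polynomial
open scoped Pointwise

noncomputable section

namespace Literature.NumberTheory.GaloisRepresentations

/-! ### Preliminaries in a Dedekind domain with a group action -/

section Prelim

variable {S : Type*} [CommRing S]

/-- **Finer perturbation of a product**: if `f i ≡ g i (mod I)` and `f i, g i ∈ J` for all `i`,
then `∏ f i - ∏ g i ∈ I J^{n-1}` (`n` the number of factors). [folklore] -/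
theorem prod_sub_prod_mem_mul_pow {ι : Type*} (I J : Ideal S) (s : Finset ι) (f g : ι → S)
    (h : ∀ i ∈ s, f i - g i ∈ I) (hf : ∀ i ∈ s, f i ∈ J) (hg : ∀ i ∈ s, g i ∈ J) :
    ∏ i ∈ s, f i - ∏ i ∈ s, g i ∈ I * J ^ (s.card - 1) := by
  classical
  induction s using Finset.induction_on with
  | empty => simp
  | insert a s ha ih =>
    rw [Finset.prod_insert ha, Finset.prod_insert ha, Finset.card_insert_of_notMem ha,
      Nat.add_sub_cancel,
      show f a * ∏ i ∈ s, f i - g a * ∏ i ∈ s, g i =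
        f a * (∏ i ∈ s, f i - ∏ i ∈ s, g i) + (f a - g a) * ∏ i ∈ s, g i by ring]
    have h' := fun i hi => h i (Finset.mem_insert_of_mem hi)
    have hf' := fun i hi => hf i (Finset.mem_insert_of_mem hi)
    have hg' := fun i hi => hg i (Finset.mem_insert_of_mem hi)
    refine Ideal.add_mem _ ?_ ?_
    · rcases Nat.eq_zero_or_pos s.card with h0 | hpos
      · rw [Finset.card_eq_zero.mp h0]; simp
      · have h1 := ih h' hf' hg'
        have : s.card = (s.card - 1) + 1 := by omega
        rw [mul_comm (f a), this, pow_succ, ← mul_assoc]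
        exact Ideal.mul_mem_mul h1 (hf a (Finset.mem_insert_self a s))
    · have hprod : ∏ i ∈ s, g i ∈ J ^ s.card := by
        have := Ideal.prod_mem_prod (s := s) (I := fun _ => J) fun i hi => hg' i hi
        rwa [Finset.prod_const] at this
      exact Ideal.mul_mem_mul (h a (Finset.mem_insert_self a s)) hprod

/-- **Almost inverses of invariant principal units, explicitly**: `(1 + i) Σ_{k<B} (-i)^k ≡ 1 (mod 𝔓^B)`
for `i ∈ 𝔓`; the inverse is a polynomial in `i`, hence invariant under every automorphism
fixing `i`. [folklore] -/
theorem one_add_mul_geom_sum_sub_one_mem_pow (P : Ideal S) {i : S} (hi : i ∈ P) (B : ℕ) :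
    (1 + i) * (∑ k ∈ Finset.range B, (-i) ^ k) - 1 ∈ P ^ B := by
  have h : (1 + i) * (∑ k ∈ Finset.range B, (-i) ^ k) = 1 - (-i) ^ B := by
    rw [← mul_neg_geom_sum (-i) B, sub_neg_eq_add]
  rw [h, sub_sub_cancel_left, neg_mem_iff, neg_pow]
  exact Ideal.mul_mem_left _ _ (Ideal.pow_mem_pow hi B)

variable [IsDedekindDomain S] (P : Ideal S) [P.IsMaximal]

/-- `𝔓^{κ+j} ⊆ q 𝔓^j + 𝔓^{κ+j+1}` for `v_𝔓(q) = κ` (the class of `q` generates every layer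
`𝔓^{κ+j}/𝔓^{κ+j+1}` as a module over the layers of `S`). [folklore] -/
theorem pow_add_le_span_mul_pow_sup (hP : P ≠ ⊥) {q : S} {κ : ℕ} (hq : ordIdeal P q = κ) (j : ℕ) :
    P ^ (κ + j) ≤ Ideal.span {q} * P ^ j ⊔ P ^ (κ + j + 1) := by
  have h := pow_le_span_sup_pow_succ P hP hq
  calc P ^ (κ + j) = P ^ κ * P ^ j := pow_add _ _ _
    _ ≤ (Ideal.span {q} ⊔ P ^ (κ + 1)) * P ^ j := Ideal.mul_mono_left h
    _ = Ideal.span {q} * P ^ j ⊔ P ^ (κ + j + 1) := by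
        rw [Ideal.sup_mul, ← pow_add, show κ + 1 + j = κ + j + 1 by omega]

/-- **Approximate division** (replacing local units `p/q ∈ S_𝔓^×` by elements of `S`): if
`v(q) = κ` and `p ∈ 𝔓^κ` then for every `N` there is `y ∈ S` with `p ≡ q y (mod 𝔓^{κ+N})`.
[folklore] -/
theorem exists_sub_mul_mem_pow (hP : P ≠ ⊥) {q p : S} {κ : ℕ} (hq : ordIdeal P q = κ)
    (hp : p ∈ P ^ κ) (N : ℕ) : ∃ y : S, p - q * y ∈ P ^ (κ + N) := by
  induction N with
  | zero => exact ⟨0, by simpa using hp⟩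
  | succ N ih =>
    obtain ⟨y, hy⟩ := ih
    obtain ⟨e, he, f, hf, hef⟩ := Submodule.mem_sup.mp (pow_add_le_span_mul_pow_sup P hP hq N hy)
    obtain ⟨b, hb, rfl⟩ := Ideal.mem_span_singleton_mul.mp he
    refine ⟨y + b, ?_⟩
    rw [show p - q * (y + b) = (p - q * y) - q * b by ring, ← hef, add_sub_cancel_left,
      show κ + (N + 1) = κ + N + 1 by omega]
    exact hf

variable {G : Type*} [Group G] [MulSemiringAction G S]

omit [IsDedekindDomain S] [P.IsMaximal] in
/-- **`ψ(ℕ) ⊆ ℕ`** (Serre IV §3 Prop. 13 d), integer form): for a finite group `Γ = Γ_0` acting,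
every multiple `n |Γ|` is a value `S_Γ(u) = Σ_{i=1}^{u} |Γ_i|` — take `u` maximal with
`S(u) ≤ n|Γ|`; `|Γ_{u+1}|` divides both `S(u)` and `n|Γ|`, and `S(u+1) = S(u) + |Γ_{u+1}| > n|Γ|`.
Ref: Serre, *Local Fields*, Ch. IV §3, Prop. 13 d) ("if `ν` is an integer, so is `ψ(ν)`").
[cite: SerreLocalFields1979, Ch. IV §3 Prop. 13] -/
theorem exists_ramificationCardSum_eq (Γ : Subgroup G) [Finite Γ]
    (h0 : P.ramificationSubgroup Γ 0 = ⊤) (n : ℕ) :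
    ∃ u : ℕ, ramificationCardSum P Γ u = n * Nat.card Γ := by
  classical
  set r := Nat.card Γ with hr
  have hmono := ramificationCardSum_strictMono P Γ
  have hge : ∀ u, u ≤ ramificationCardSum P Γ u := fun u => hmono.le_apply
  set u := Nat.findGreatest (fun u => ramificationCardSum P Γ u ≤ n * r) (n * r) with hu
  have hu1 : ramificationCardSum P Γ u ≤ n * r :=
    Nat.findGreatest_spec (P := fun u => ramificationCardSum P Γ u ≤ n * r) (Nat.zero_le _)
      (by simp)
  have hu2 : n * r < ramificationCardSum P Γ (u + 1) := by
    by_contra hle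
    rw [not_lt] at hle
    have hle' : u + 1 ≤ n * r := (hge (u + 1)).trans hle
    exact Nat.lt_irrefl u (Nat.lt_of_succ_le
      (Nat.le_findGreatest (P := fun u => ramificationCardSum P Γ u ≤ n * r) hle' hle))
  refine ⟨u, le_antisymm hu1 ?_⟩
  -- `d = |Γ_{u+1}|` divides `S(u)` and `n r`, and `S(u+1) = S(u) + d`
  set d := Nat.card (P.ramificationSubgroup Γ (u + 1)) with hd
  rw [ramificationCardSum_succ] at hu2
  have hdS : d ∣ ramificationCardSum P Γ u := by
    rw [ramificationCardSum]
    refine Finset.dvd_sum fun i hi => Subgroup.card_dvd_of_le (P.ramificationSubgroup_antitone Γ ?_)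
    have := (Finset.mem_Icc.mp hi).2
    omega
  have hdr : d ∣ n * r := Dvd.dvd.mul_left (by
    rw [hr, ← Subgroup.card_top (G := Γ), ← h0]
    exact Subgroup.card_dvd_of_le (P.ramificationSubgroup_antitone Γ (Nat.zero_le _))) n
  obtain ⟨a, ha⟩ := hdS
  obtain ⟨b, hb⟩ := hdr
  rw [ha] at hu1 hu2 ⊢
  rw [hb] at hu1 hu2 ⊢
  have hdpos : 0 < d := Nat.card_pos
  have h1 : b < a + 1 := by
    by_contra h; rw [not_lt] at h; nlinarith
  nlinarith

end Prelim

section OrdHelpers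

variable {S : Type*} [CommRing S] [IsDedekindDomain S] (P : Ideal S)

/-- `v(a) = k` from `a ∈ 𝔓^k`, `a ∉ 𝔓^{k+1}`. [folklore] -/
theorem ordIdeal_eq_of_mem_of_not_mem {a : S} {k : ℕ} (h1 : a ∈ P ^ k) (h2 : a ∉ P ^ (k + 1)) :
    ordIdeal P a = k := by
  rw [← le_ordIdeal_iff_mem_pow] at h1 h2
  induction h : ordIdeal P a using ENat.recTopCoe with
  | top => rw [h] at h2; exact absurd le_top h2
  | coe n =>
    rw [h] at h1 h2
    have h1' : k ≤ n := by exact_mod_cast h1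
    have h2' : ¬ k + 1 ≤ n := fun h' => h2 (by exact_mod_cast h')
    exact_mod_cast (show n = k by omega)

/-- `a ∉ 𝔓^{k+1}` from `v(a) = k`. [folklore] -/
theorem not_mem_pow_succ_of_ordIdeal_eq {a : S} {k : ℕ} (h : ordIdeal P a = k) : a ∉ P ^ (k + 1) := by
  rw [← le_ordIdeal_iff_mem_pow, h]
  exact_mod_cast Nat.not_succ_le_self k

/-- `a ∈ 𝔓^k` from `v(a) = k`. [folklore] -/
theorem mem_pow_of_ordIdeal_eq {a : S} {k : ℕ} (h : ordIdeal P a = k) : a ∈ P ^ k := by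
  rw [← le_ordIdeal_iff_mem_pow, h]

end OrdHelpers

/-! ### Two lemmas on the totally ramified layer `S ⊇ S^Γ`: invariant orders, approximate independence -/

section Layer

variable (R : Type*) {K L : Type*} [CommRing R] [Field K] [Field L] [Algebra R K] [Algebra R L]
  [Algebra K L] [IsScalarTower R K L]

attribute [local instance] integralClosureAlgebra integralClosure_isScalarTower_left
  integralClosure_isScalarTower_bot integralClosure_faithfulSMul integralClosure_isIntegral
  integralClosure_isTorsionFree isMaximal_under_integralClosure under_integralClosure_liesOver
  residueAlgebra residueSMul isScalarTower_residue

variable (F : IntermediateField K L) [IsDedekindDomain R] [IsFractionRing R K]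
  [FiniteDimensional K L] [IsGalois K L]
  (𝔓 : Ideal (integralClosure R L)) [𝔓.IsMaximal]

/-- **Orders of invariant elements are multiples of `|Γ|`** (total ramification:
`v_𝔓 ∘ ι = |Γ| · v_{𝔓 ∩ S^Γ}`): for `t ∈ S` fixed by `Γ = Gal(L/F) ≤ T_𝔓` with `v_𝔓(t) = k`,
`|Γ| ∣ k`.  (Serre V §7, Lemma 8: `v(x) ≡ 0 mod r` for `x ∈ K^*`.)
Ref: Serre, *Local Fields*, Ch. V §7, Lemma 8. [cite: SerreLocalFields1979, Ch. V §7 Lemma 8] -/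
theorem card_dvd_of_invariant_of_ordIdeal_eq [Fintype F.fixingSubgroup] (h𝔓 : 𝔓 ≠ ⊥)
    [Algebra.IsSeparable (R ⧸ 𝔓.under R) (integralClosure R L ⧸ 𝔓)]
    (hF : F.fixingSubgroup ≤ 𝔓.inertia (L ≃ₐ[K] L)) {t : integralClosure R L}
    (ht : ∀ γ : F.fixingSubgroup, (γ : L ≃ₐ[K] L) • t = t) {k : ℕ} (hk : ordIdeal 𝔓 t = k) :
    Fintype.card F.fixingSubgroup ∣ k := by
  haveI : IsDedekindDomain (integralClosure R L) := integralClosure.isDedekindDomain R K L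
  haveI : IsDedekindDomain (integralClosure R F) := integralClosure.isDedekindDomain R K F
  haveI : Algebra.IsIntegral (integralClosure R F) (integralClosure R L) :=
    integralClosure_isIntegral R F
  haveI h𝔓prime : 𝔓.IsPrime := Ideal.IsMaximal.isPrime inferInstance
  haveI hGal : IsGaloisGroup F.fixingSubgroup (integralClosure R F) (integralClosure R L) :=
    isGaloisGroup_fixingSubgroup_integralClosure R F
  haveI : Algebra.IsInvariant (integralClosure R F) (integralClosure R L) F.fixingSubgroup :=
    hGal.isInvariant
  obtain ⟨t₀, rfl⟩ : ∃ t₀ : integralClosure R F,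
      algebraMap (integralClosure R F) (integralClosure R L) t₀ = t :=
    Algebra.IsInvariant.isInvariant (A := integralClosure R F) (G := F.fixingSubgroup) t ht
  have h𝔓F : 𝔓.under (integralClosure R F) ≠ ⊥ := Ideal.IsIntegral.comap_ne_bot _ h𝔓
  have hmap := map_under_eq_pow_card R F 𝔓 h𝔓 hF
  set n := Fintype.card F.fixingSubgroup with hn
  have hn0 : n ≠ 0 := Fintype.card_ne_zero
  have hemap : emultiplicity 𝔓 ((𝔓.under (integralClosure R F)).map
      (algebraMap (integralClosure R F) (integralClosure R L))) = n := by
    rw [hmap, emultiplicity_pow_self h𝔓 (fun hu => Ideal.IsPrime.ne_top inferInstance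
      (Ideal.isUnit_iff.mp hu))]
  have hord := ordIdeal_algebraMap (𝔓 := 𝔓) h𝔓 h𝔓F (by rw [hmap]; exact Ideal.pow_le_self hn0) t₀
  rw [hemap, hk] at hord
  induction h : (ordIdeal (𝔓.under (integralClosure R F)) t₀) using ENat.recTopCoe with
  | top => rw [h] at hord; exact absurd hord (by simp [hn0])
  | coe m =>
    rw [h] at hord
    exact ⟨m, by exact_mod_cast (by rw [mul_comm] at hord; exact_mod_cast hord : (k : ℕ∞) = n * m)⟩

set_option maxHeartbeats 800000 in
/-- **Approximate independence of characters** (Dedekind's argument made quantitative; the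
completion-free substitute for Hilbert's Theorem 90 in Serre's Lemma 12 a)).  Let
`Γ = Gal(L/F) ≤ T_𝔓` and `x₀ ∈ S` with `v(γ x₀ - x₀) ≤ C` for all `γ ≠ 1` in `Γ`
(e.g. a local generator, `v(γ x - x) = i_Γ(γ)`).  If for a finite set `T ⊆ Γ` and
coefficients `a_σ ∈ S` one has `Σ_{σ ∈ T} a_σ σ(t) ∈ 𝔓^{N + (|T|-1)(C+1)}` for **all** `t ∈ S`,
then `a_σ ∈ 𝔓^N` for all `σ ∈ T`.  Proof: `R(x₀ t) - σ₁(x₀) R(t) = Σ_{σ ≠ σ₁} a_σ (σ x₀ - σ₁ x₀) σ(t)`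
removes `σ₁`; induct, and cancel `σ x₀ - σ₁ x₀ ∉ 𝔓^{C+1}`.
Ref: Bourbaki, *Alg.* V §6 (Dedekind's independence of characters); used in place of
Serre V §7 Lemma 12 a)'s appeal to Hilbert 90. [folklore] -/
theorem mem_pow_of_forall_sum_mul_smul_mem_pow
    (hF : F.fixingSubgroup ≤ 𝔓.inertia (L ≃ₐ[K] L)) (h𝔓 : 𝔓 ≠ ⊥) {C : ℕ} (x₀ : integralClosure R L)
    (hx₀ : ∀ γ : F.fixingSubgroup, γ ≠ 1 → (γ : L ≃ₐ[K] L) • x₀ - x₀ ∉ 𝔓 ^ (C + 1)) :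
    ∀ (T : Finset F.fixingSubgroup) (a : F.fixingSubgroup → integralClosure R L) (N : ℕ),
      (∀ t : integralClosure R L,
        ∑ σ ∈ T, a σ * (σ : L ≃ₐ[K] L) • t ∈ 𝔓 ^ (N + (T.card - 1) * (C + 1))) →
      ∀ σ ∈ T, a σ ∈ 𝔓 ^ N := by
  classical
  haveI : IsDedekindDomain (integralClosure R L) := integralClosure.isDedekindDomain R K L
  haveI h𝔓prime : 𝔓.IsPrime := Ideal.IsMaximal.isPrime inferInstance
  have hstab : ∀ g : F.fixingSubgroup, (g : L ≃ₐ[K] L) • 𝔓 = 𝔓 := fun g =>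
    (Ideal.inertia_le_stabilizer 𝔓) (hF g.2)
  intro T
  induction T using Finset.induction_on with
  | empty => intro a N _ σ hσ; exact absurd hσ (Finset.notMem_empty σ)
  | insert σ₁ T hσ₁ ih =>
    intro a N hR σ hσ
    rw [Finset.card_insert_of_notMem hσ₁, Nat.add_sub_cancel] at hR
    -- the coefficients `a_σ (σ x₀ - σ₁ x₀)` on `T` satisfy the hypothesis with `N + C + 1`
    have hT : ∀ σ ∈ T, a σ ∈ 𝔓 ^ N := by
      rcases Nat.eq_zero_or_pos T.card with h0 | hpos
      · intro σ hσ; rw [Finset.card_eq_zero.mp h0] at hσ; exact absurd hσ (Finset.notMem_empty σ)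
      have hR' : ∀ t : integralClosure R L, ∑ σ ∈ T,
          (a σ * ((σ : L ≃ₐ[K] L) • x₀ - (σ₁ : L ≃ₐ[K] L) • x₀)) * (σ : L ≃ₐ[K] L) • t ∈
          𝔓 ^ (N + (C + 1) + (T.card - 1) * (C + 1)) := by
        intro t
        have h1 := hR (x₀ * t)
        have h2 := Ideal.mul_mem_left _ ((σ₁ : L ≃ₐ[K] L) • x₀) (hR t)
        have hexp : N + (C + 1) + (T.card - 1) * (C + 1) = N + T.card * (C + 1) := by
          have : T.card = T.card - 1 + 1 := by omega
          conv_rhs => rw [this]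
          ring
        have key : ∑ σ ∈ T, a σ * ((σ : L ≃ₐ[K] L) • x₀ - (σ₁ : L ≃ₐ[K] L) • x₀) * (σ : L ≃ₐ[K] L) • t =
            (∑ σ ∈ insert σ₁ T, a σ * (σ : L ≃ₐ[K] L) • (x₀ * t)) -
              (σ₁ : L ≃ₐ[K] L) • x₀ * ∑ σ ∈ insert σ₁ T, a σ * (σ : L ≃ₐ[K] L) • t := by
          rw [Finset.sum_insert hσ₁, Finset.sum_insert hσ₁, mul_add, Finset.mul_sum]
          simp only [smul_mul']
          have hAC : a σ₁ * ((σ₁ : L ≃ₐ[K] L) • x₀ * (σ₁ : L ≃ₐ[K] L) • t) =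
              (σ₁ : L ≃ₐ[K] L) • x₀ * (a σ₁ * (σ₁ : L ≃ₐ[K] L) • t) := by ring
          rw [hAC, add_sub_add_left_eq_sub, ← Finset.sum_sub_distrib]
          exact Finset.sum_congr rfl fun σ _ => by ring
        rw [hexp, key]
        exact Ideal.sub_mem _ h1 h2
      intro σ hσT
      have h := ih _ _ hR' σ hσT
      -- cancel `σ x₀ - σ₁ x₀ ∉ 𝔓^{C+1}`
      have hne : σ₁⁻¹ * σ ≠ 1 := by
        intro h1
        rw [inv_mul_eq_one] at h1
        exact hσ₁ (h1 ▸ hσT)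
      have hnot : (σ : L ≃ₐ[K] L) • x₀ - (σ₁ : L ≃ₐ[K] L) • x₀ ∉ 𝔓 ^ (C + 1) := by
        intro hmem
        apply hx₀ (σ₁⁻¹ * σ) hne
        have h2 := smul_mem_pow_of_smul_eq 𝔓 (hstab σ₁⁻¹) hmem
        rw [smul_sub, Subgroup.coe_inv, smul_smul, smul_smul, inv_mul_cancel, one_smul] at h2
        rw [Subgroup.coe_mul, Subgroup.coe_inv]
        exact h2
      obtain ⟨k, hk⟩ : ∃ k : ℕ, ordIdeal 𝔓 ((σ : L ≃ₐ[K] L) • x₀ - (σ₁ : L ≃ₐ[K] L) • x₀) = k := by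
        induction h' : ordIdeal 𝔓 ((σ : L ≃ₐ[K] L) • x₀ - (σ₁ : L ≃ₐ[K] L) • x₀)
          using ENat.recTopCoe with
        | top => exact absurd (by rw [← le_ordIdeal_iff_mem_pow, h']; exact le_top) hnot
        | coe k => exact ⟨k, rfl⟩
      have hkC : k ≤ C := by
        by_contra hlt
        exact hnot (by rw [← le_ordIdeal_iff_mem_pow, hk]; exact_mod_cast (by omega : C + 1 ≤ k))
      refine mem_pow_of_mul_mem_pow_add 𝔓 h𝔓 hk (t := a σ) (M := N) ?_
      rw [mul_comm]
      exact Ideal.pow_le_pow_right (by omega) h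
    -- the coefficient of `σ₁`: evaluate at `t = 1`
    rcases Finset.mem_insert.mp hσ with rfl | hσT
    · have h1 := hR 1
      rw [Finset.sum_insert hσ₁] at h1
      simp only [smul_one, mul_one] at h1
      have h2 : ∑ σ ∈ T, a σ ∈ 𝔓 ^ N := Ideal.sum_mem _ fun σ hσ => hT σ hσ
      have h3 := Ideal.sub_mem _ (Ideal.pow_le_pow_right (Nat.le_add_right _ _) h1) h2
      rwa [add_sub_cancel_right] at h3
    · exact hT σ hσT

end Layer

/-! ### Reindexing a cyclic group by the powers of a generator; invariance of `N(1+y)` -/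

section Cyclic

variable {G : Type*} [Group G]

/-- For a finite cyclic subgroup `Γ = ⟨s⟩`: `Fin |Γ| ≃ Γ`, `i ↦ s^i`. [folklore] -/
theorem exists_fin_equiv_pow {s : G} {Γ : Subgroup G} (hs : Subgroup.zpowers s = Γ) [Fintype Γ] :
    ∃ e : Fin (Fintype.card Γ) ≃ Γ, ∀ i, ((e i : Γ) : G) = s ^ (i : ℕ) := by
  classical
  haveI : Finite (Subgroup.zpowers s) := by rw [hs]; infer_instance
  have hfin : IsOfFinOrder s := by
    rw [← orderOf_pos_iff, ← Nat.card_zpowers]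
    exact Nat.card_pos
  have hord : orderOf s = Fintype.card Γ := by
    rw [← Nat.card_zpowers, hs, Nat.card_eq_fintype_card]
  refine ⟨(finCongr hord.symm).trans ((finEquivZPowers hfin).trans
    (MulEquiv.subgroupCongr hs).toEquiv), fun i => ?_⟩
  simp only [Equiv.trans_apply, finEquivZPowers_apply, finCongr_apply, Fin.val_cast]
  rfl

variable {S : Type*} [CommRing S] [MulSemiringAction G S]

omit [MulSemiringAction G S] in
/-- Sums over `Γ = ⟨s⟩` as sums over the powers `s^i`, `i < |Γ|`. [folklore] -/
theorem sum_range_pow_smul_eq {s : G} {Γ : Subgroup G} [Fintype Γ] (e : Fin (Fintype.card Γ) ≃ Γ)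
    (he : ∀ i, ((e i : Γ) : G) = s ^ (i : ℕ)) (f : G → S) :
    ∑ i ∈ Finset.range (Fintype.card Γ), f (s ^ i) = ∑ h : Γ, f (h : G) := by
  rw [Finset.sum_range]
  exact Fintype.sum_equiv e _ _ fun i => by rw [he]

omit [MulSemiringAction G S] in
/-- Products over `Γ = ⟨s⟩` as products over the powers `s^i`, `i < |Γ|`. [folklore] -/
theorem prod_range_pow_smul_eq {s : G} {Γ : Subgroup G} [Fintype Γ] (e : Fin (Fintype.card Γ) ≃ Γ)
    (he : ∀ i, ((e i : Γ) : G) = s ^ (i : ℕ)) (f : G → S) :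
    ∏ i ∈ Finset.range (Fintype.card Γ), f (s ^ i) = ∏ h : Γ, f (h : G) := by
  rw [Finset.prod_range]
  exact Fintype.prod_equiv e _ _ fun i => by rw [he]

/-- `N(1 + y) = ∏_{h ∈ Γ} (1 + h y)` is `Γ`-invariant. [folklore] -/
theorem smul_prod_one_add_smul (Γ : Subgroup G) [Fintype Γ] (g : Γ) (y : S) :
    (g : G) • ∏ h : Γ, (1 + (h : G) • y) = ∏ h : Γ, (1 + (h : G) • y) := by
  rw [Finset.smul_prod']
  simp only [smul_add, smul_one, smul_smul]
  exact Fintype.prod_bijective (g * ·) (Group.mulLeft_bijective g) _ _ fun h => rfl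

/-- `N((1 + y)(1 + w)) = N(1 + y) N(1 + w)` in the form `1 + (y + w + y w)`. [folklore] -/
theorem prod_one_add_smul_add (Γ : Subgroup G) [Fintype Γ] (y w : S) :
    ∏ h : Γ, (1 + (h : G) • (y + w + y * w)) =
      (∏ h : Γ, (1 + (h : G) • y)) * ∏ h : Γ, (1 + (h : G) • w) := by
  rw [← Finset.prod_mul_distrib]
  refine Finset.prod_congr rfl fun h _ => ?_
  rw [smul_add, smul_add, smul_mul']; ring

end Cyclic

/-! ### Serre V §7, Lemma 12 a) (approximate form): resolvents of level `m` with bounded valuation -/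

section Resolvent

variable (R : Type*) {K L : Type*} [CommRing R] [Field K] [Field L] [Algebra R K] [Algebra R L]
  [Algebra K L] [IsScalarTower R K L]

attribute [local instance] integralClosureAlgebra integralClosure_isScalarTower_left
  integralClosure_isScalarTower_bot integralClosure_faithfulSMul integralClosure_isIntegral
  integralClosure_isTorsionFree isMaximal_under_integralClosure under_integralClosure_liesOver
  residueAlgebra residueSMul isScalarTower_residue

variable (F : IntermediateField K L) [IsDedekindDomain R] [IsFractionRing R K]
  [FiniteDimensional K L] [IsGalois K L]
  (𝔓 : Ideal (integralClosure R L)) [𝔓.IsMaximal]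

/-- The shift identity behind the Lagrange resolvent: with
`a_i = (∏_{l<i} s^l x)(∏_{i ≤ l < r} s^l y)` and `s^r y = y`, `x · s(a_i) = y · a_{i+1}`.
[folklore] -/
theorem mul_smul_resolventCoeff {S : Type*} [CommRing S] {G : Type*} [Group G] [MulSemiringAction G S]
    (s : G) (x y : S) {r : ℕ} (hsr : s ^ r • y = y) {i : ℕ} (hi : i < r) :
    x * s • ((∏ l ∈ Finset.range i, (s ^ l) • x) * ∏ l ∈ Finset.Ico i r, (s ^ l) • y) =
      y * ((∏ l ∈ Finset.range (i + 1), (s ^ l) • x) * ∏ l ∈ Finset.Ico (i + 1) r, (s ^ l) • y) := by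
  rw [smul_mul', Finset.smul_prod', Finset.smul_prod']
  simp only [smul_smul, ← pow_succ']
  rw [Finset.prod_range_succ' (fun l => (s ^ l) • x) i, pow_zero, one_smul,
    Finset.prod_Ico_add' (fun l => (s ^ l) • y) i r 1]
  rcases Nat.lt_or_ge (i + 1) r with h | h
  · have hr : r = (r - 1) + 1 := by omega
    conv_lhs => rw [hr, Finset.prod_Ico_succ_top (by omega : i + 1 ≤ r - 1 + 1), ← hr, hsr]
    ring
  · have hr : i + 1 = r := by omega
    rw [hr, Finset.Ico_self, Finset.prod_empty, show r + 1 = r + 1 from rfl,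
      Finset.prod_Ico_succ_top le_rfl, Finset.Ico_self, Finset.prod_empty, hsr]
    ring

set_option maxHeartbeats 3200000 in
/-- **Serre V §7, Lemma 12 a), completion-free.**  Let `Γ = Gal(L/F) = ⟨s⟩ ≤ T_𝔓` be cyclic of
order `r` with the norm properties of `NormFiltration`, `x₀` with `v(γ x₀ - x₀) ≤ C` (`γ ≠ 1`), and
`m` with `n < φ(m) < n + 1` (`n r < S(m) < (n+1) r`) and `Γ_{m+1} = 1`.  Then for every
`ξ ∈ 𝔓^m` there is `z ∈ S`, `v(z) = k ≤ (r-1)(C+1)`, with `(1 + ξ) s(z) ≡ z (mod 𝔓^{m+1+k})`,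
i.e. the cocycle `c(z) = s z / z` satisfies `c(z) ≡ (1 + ξ)⁻¹ (mod U^{m+1})` — the image of
`V_m → U^m/U^{m+1}` is everything.  Proof: successive approximation with `NormFiltration.surj`
gives `y ≡ 0 (mod 𝔓^{m+1})` with `N(1+ξ) ≡ N(1+y) (mod 𝔓^{rB})`; the Lagrange resolvent
`z = Σ_i a_i s^i(t)`, `a_i = ∏_{l<i} s^l(1+ξ) ∏_{l ≥ i} s^l(1+y)`, satisfies
`(1+ξ) s(z) - (1+y) z = (1+y) t (N(1+ξ) - N(1+y))`, and by approximate independence some `t`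
gives `v(z) ≤ (r-1)(C+1)`.
Ref: Serre, *Local Fields*, Ch. V §7, Lemma 12 a) (with Cor. 3 of §6 and Hilbert 90 replaced as
described in the module docstring). [cite: SerreLocalFields1979, Ch. V §7 Lemma 12] -/
theorem exists_resolvent (hF : F.fixingSubgroup ≤ 𝔓.inertia (L ≃ₐ[K] L)) (h𝔓 : 𝔓 ≠ ⊥)
    [Algebra.IsSeparable (R ⧸ 𝔓.under R) (integralClosure R L ⧸ 𝔓)]
    (hNF : NormFiltration 𝔓 F.fixingSubgroup) {s : L ≃ₐ[K] L}
    (hs : Subgroup.zpowers s = F.fixingSubgroup)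
    {C : ℕ} (x₀ : integralClosure R L)
    (hx₀ : ∀ γ : F.fixingSubgroup, γ ≠ 1 → (γ : L ≃ₐ[K] L) • x₀ - x₀ ∉ 𝔓 ^ (C + 1))
    {m n : ℕ} (hmn : n * Nat.card F.fixingSubgroup < ramificationCardSum 𝔓 F.fixingSubgroup m)
    (hmn' : ramificationCardSum 𝔓 F.fixingSubgroup m < (n + 1) * Nat.card F.fixingSubgroup)
    (hbot : 𝔓.ramificationSubgroup F.fixingSubgroup (m + 1) = ⊥)
    {ξ : integralClosure R L} (hξ : ξ ∈ 𝔓 ^ m) :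
    ∃ (z : integralClosure R L) (k : ℕ), ordIdeal 𝔓 z = k ∧
      k ≤ (Nat.card F.fixingSubgroup - 1) * (C + 1) ∧ (1 + ξ) * s • z - z ∈ 𝔓 ^ (m + 1 + k) := by
  classical
  haveI : IsDedekindDomain (integralClosure R L) := integralClosure.isDedekindDomain R K L
  haveI h𝔓prime : 𝔓.IsPrime := Ideal.IsMaximal.isPrime inferInstance
  obtain ⟨r, hr⟩ : ∃ r, Nat.card F.fixingSubgroup = r := ⟨_, rfl⟩
  have hrF : Fintype.card F.fixingSubgroup = r := by rw [← Nat.card_eq_fintype_card, hr]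
  have hrpos : 0 < r := by rw [← hr]; exact Nat.card_pos
  rw [hr] at hmn hmn' ⊢
  have hstab : ∀ g : F.fixingSubgroup, (g : L ≃ₐ[K] L) • 𝔓 = 𝔓 := fun g =>
    (Ideal.inertia_le_stabilizer 𝔓) (hF g.2)
  have hspow : ∀ l : ℕ, s ^ l ∈ F.fixingSubgroup := fun l => hs ▸ Subgroup.pow_mem _ (Subgroup.mem_zpowers s) l
  have hstabl : ∀ l : ℕ, (s ^ l) • 𝔓 = 𝔓 := fun l => hstab ⟨s ^ l, hspow l⟩
  have hsr : s ^ r = 1 := by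
    rw [← hr, ← hs, Nat.card_zpowers]; exact pow_orderOf_eq_one s
  obtain ⟨e, he⟩ := exists_fin_equiv_pow hs
  have h0 : 𝔓.ramificationSubgroup F.fixingSubgroup 0 = ⊤ := by
    refine eq_top_iff.mpr fun h _ => ?_
    rw [Ideal.ramificationSubgroup_zero]
    exact (AddSubgroup.mem_inertia (I := 𝔓.toAddSubgroup)).mpr fun z =>
      (AddSubgroup.mem_inertia (I := 𝔓.toAddSubgroup)).mp (hF h.2) z
  have hu : ∀ B, ∃ u, ramificationCardSum 𝔓 F.fixingSubgroup u = B * r := fun B => by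
    rw [← hr]; exact exists_ramificationCardSum_eq 𝔓 F.fixingSubgroup h0 B
  have hmono := ramificationCardSum_strictMono 𝔓 F.fixingSubgroup
  obtain ⟨un, hun⟩ := hu n
  have hm_un : un + 1 ≤ m := Nat.succ_le_of_lt (hmono.lt_iff_lt.mp (by rw [hun]; exact hmn))
  have huB : ∀ B, n + 1 ≤ B → ∀ u, ramificationCardSum 𝔓 F.fixingSubgroup u = B * r →
      m + 1 ≤ u ∧ 𝔓.ramificationSubgroup F.fixingSubgroup u = ⊥ := by
    intro B hB u huu
    have hlt : m < u := hmono.lt_iff_lt.mp (by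
      rw [huu]; exact hmn'.trans_le (Nat.mul_le_mul_right r hB))
    exact ⟨hlt, le_bot_iff.mp (hbot ▸ 𝔓.ramificationSubgroup_antitone _ (Nat.succ_le_of_lt hlt))⟩
  -- the norm `N(1 + y)` and its invariance
  set Nm : integralClosure R L → integralClosure R L :=
    fun y => ∏ h : F.fixingSubgroup, (1 + (h : L ≃ₐ[K] L) • y) with hNm
  have hNfix : ∀ (g : F.fixingSubgroup) (y), (g : L ≃ₐ[K] L) • Nm y = Nm y := fun g y =>
    smul_prod_one_add_smul F.fixingSubgroup g y
  have hun' : ramificationCardSum 𝔓 F.fixingSubgroup un = n * Nat.card F.fixingSubgroup := by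
    rw [hr]; exact hun
  have hlev := hNF.level n un hun'
  rw [hr] at hlev
  have hm_un1 : un + 1 ≤ m + 1 := hm_un.trans (Nat.le_succ m)
  ------------------------------------------------------------------
  -- Step 1: successive approximation `N(1 + ξ) ≡ N(1 + y) mod 𝔓^{rB}`, `y ∈ 𝔓^{m+1}`
  ------------------------------------------------------------------
  have happrox : ∀ B, n + 1 ≤ B → ∃ y ∈ 𝔓 ^ (m + 1), Nm ξ - Nm y ∈ 𝔓 ^ (B * r) := by
    intro B hB
    induction B, hB using Nat.le_induction with
    | base =>
      refine ⟨0, Submodule.zero_mem _, ?_⟩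
      have h1 := hlev.2 ξ (Ideal.pow_le_pow_right hm_un hξ)
      have hN0 : Nm 0 = 1 := by simp [hNm]
      rwa [hN0]
    | succ B hB ih =>
      obtain ⟨y, hy, hδ⟩ := ih
      obtain ⟨uB, huB'⟩ := hu B
      obtain ⟨hmuB, hΓuB⟩ := huB B hB uB huB'
      have hι₀ : Nm y - 1 ∈ 𝔓 ^ ((n + 1) * r) := hlev.2 y (Ideal.pow_le_pow_right hm_un1 hy)
      have hι₀' : Nm y - 1 ∈ 𝔓 := Ideal.pow_le_self (Nat.mul_ne_zero (Nat.succ_ne_zero n) hrpos.ne') hι₀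
      set c := ∑ k ∈ Finset.range ((B + 1) * r), (-(Nm y - 1)) ^ k with hc
      have hcinv : (1 + (Nm y - 1)) * c - 1 ∈ 𝔓 ^ ((B + 1) * r) :=
        one_add_mul_geom_sum_sub_one_mem_pow 𝔓 hι₀' _
      have hcfix : ∀ g : F.fixingSubgroup, (g : L ≃ₐ[K] L) • c = c := fun g => by
        simp only [hc, Finset.smul_sum, smul_pow', smul_neg, smul_sub, smul_one, hNfix]
      set δ' := (Nm ξ - Nm y) * c with hδ'
      have hδ'mem : δ' ∈ 𝔓 ^ (B * Nat.card F.fixingSubgroup) := by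
        rw [hr]; exact Ideal.mul_mem_right _ _ hδ
      have hδ'fix : ∀ g : F.fixingSubgroup, (g : L ≃ₐ[K] L) • δ' = δ' := fun g => by
        rw [hδ', smul_mul', smul_sub, hNfix, hNfix, hcfix]
      have huB'' : ramificationCardSum 𝔓 F.fixingSubgroup uB = B * Nat.card F.fixingSubgroup := by
        rw [hr]; exact huB'
      obtain ⟨w, hw, hwN⟩ := hNF.surj B uB huB'' hΓuB δ' hδ'mem hδ'fix
      rw [hr] at hwN
      refine ⟨y + w + y * w, ?_, ?_⟩
      · have hw' : w ∈ 𝔓 ^ (m + 1) := Ideal.pow_le_pow_right hmuB hw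
        exact Ideal.add_mem _ (Ideal.add_mem _ hy hw') (Ideal.mul_mem_left _ _ hw')
      · have hprod : Nm (y + w + y * w) = Nm y * Nm w := prod_one_add_smul_add F.fixingSubgroup y w
        have key : Nm ξ - Nm y * Nm w =
            -((Nm ξ - Nm y) * ((1 + (Nm y - 1)) * c - 1)) - Nm y * (Nm w - 1 - δ') := by
          rw [hδ']; ring
        rw [hprod, key]
        exact Ideal.sub_mem _ (Submodule.neg_mem _ (Ideal.mul_mem_left _ _ hcinv))
          (Ideal.mul_mem_left _ _ hwN)
  ------------------------------------------------------------------
  -- Step 2: the resolvent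
  ------------------------------------------------------------------
  set C' := (r - 1) * (C + 1) with hC'
  obtain ⟨y, hy, hδ⟩ := happrox (n + 1 + (m + 1 + C')) (Nat.le_add_right _ _)
  set x : integralClosure R L := 1 + ξ with hx
  set yy : integralClosure R L := 1 + y with hyy
  have hy1 : y ∈ 𝔓 := Ideal.pow_le_self (Nat.succ_ne_zero m) hy
  have hyy𝔓 : yy ∉ 𝔓 := fun h => Ideal.IsPrime.ne_top inferInstance
    ((Ideal.eq_top_iff_one _).mpr (by simpa [hyy] using 𝔓.sub_mem h hy1))
  have hsryy : s ^ r • yy = yy := by rw [hsr, one_smul]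
  set a : ℕ → integralClosure R L := fun i =>
    (∏ l ∈ Finset.range i, (s ^ l) • x) * ∏ l ∈ Finset.Ico i r, (s ^ l) • yy with ha
  have ha0 : a 0 ∉ 𝔓 := by
    simp only [ha, Finset.range_zero, Finset.prod_empty, one_mul]
    refine Finset.prod_induction _ (fun b => b ∉ 𝔓) (fun b₁ b₂ h₁ h₂ h₁₂ =>
      (Ideal.IsPrime.mem_or_mem inferInstance h₁₂).elim h₁ h₂)
      (fun h1 => Ideal.IsPrime.ne_top inferInstance ((Ideal.eq_top_iff_one _).mpr h1)) ?_
    intro l _ hl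
    have hl1 : (s ^ l) • yy ∈ 𝔓 ^ 1 := by rw [pow_one]; exact hl
    have h2 := smul_mem_pow_of_smul_eq 𝔓 (hstab (⟨s ^ l, hspow l⟩ : F.fixingSubgroup)⁻¹) hl1
    rw [pow_one, Subgroup.coe_inv, smul_smul, inv_mul_cancel, one_smul] at h2
    exact hyy𝔓 h2
  -- some `t` makes the resolvent shallow
  set zf : integralClosure R L → integralClosure R L :=
    fun t => ∑ i ∈ Finset.range r, a i * (s ^ i) • t with hzf
  obtain ⟨t, ht⟩ : ∃ t, zf t ∉ 𝔓 ^ (1 + C') := by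
    by_contra hall
    push Not at hall
    set b : F.fixingSubgroup → integralClosure R L := fun σ => a ((e.symm σ : Fin _) : ℕ) with hb
    have hall' : ∀ t : integralClosure R L, ∑ σ ∈ (Finset.univ : Finset F.fixingSubgroup),
        b σ * (σ : L ≃ₐ[K] L) • t ∈
        𝔓 ^ (1 + ((Finset.univ : Finset F.fixingSubgroup).card - 1) * (C + 1)) := by
      intro t
      rw [Finset.card_univ, hrF]
      have heq : ∑ σ : F.fixingSubgroup, b σ * (σ : L ≃ₐ[K] L) • t = zf t := by
        rw [hzf]
        simp only
        rw [← hrF, Finset.sum_range]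
        refine (Fintype.sum_equiv e _ _ fun i => ?_).symm
        simp only [hb, Equiv.symm_apply_apply, he]
      rw [heq]
      exact hall t
    have h0 := mem_pow_of_forall_sum_mul_smul_mem_pow R F 𝔓 hF h𝔓 x₀ hx₀ Finset.univ b 1 hall'
      (e ⟨0, by rw [hrF]; exact hrpos⟩) (Finset.mem_univ _)
    simp only [hb, Equiv.symm_apply_apply, pow_one] at h0
    exact ha0 h0
  set z := zf t with hz
  obtain ⟨k, hk⟩ : ∃ k : ℕ, ordIdeal 𝔓 z = k := by
    induction h' : ordIdeal 𝔓 z using ENat.recTopCoe with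
    | top => exact absurd (by rw [← le_ordIdeal_iff_mem_pow, h']; exact le_top) ht
    | coe k => exact ⟨k, rfl⟩
  have hkC : k ≤ C' := by
    by_contra hlt
    exact ht (by rw [← le_ordIdeal_iff_mem_pow, hk]; exact_mod_cast (by omega : 1 + C' ≤ k))
  refine ⟨z, k, hk, hkC, ?_⟩
  -- the norms as products over powers of `s`
  have hNx : ∏ l ∈ Finset.range r, (s ^ l) • x = Nm ξ := by
    rw [← hrF, prod_range_pow_smul_eq e he (fun g => g • x)]
    simp only [hNm, hx, smul_add, smul_one]
  have hNy : ∏ l ∈ Finset.range r, (s ^ l) • yy = Nm y := by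
    rw [← hrF, prod_range_pow_smul_eq e he (fun g => g • yy)]
    simp only [hNm, hyy, smul_add, smul_one]
  -- the telescoping identity `x s(z) - yy z = yy t (N x - N yy)`
  have htel : x * s • z - yy * z = yy * t * (Nm ξ - Nm y) := by
    have hsz : s • z = ∑ i ∈ Finset.range r, s • a i * (s ^ (i + 1)) • t := by
      rw [hz, hzf]
      simp only [Finset.smul_sum, smul_mul', smul_smul, ← pow_succ']
    have h1 : x * s • z = yy * ∑ i ∈ Finset.range r, a (i + 1) * (s ^ (i + 1)) • t := by
      rw [hsz, Finset.mul_sum, Finset.mul_sum]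
      refine Finset.sum_congr rfl fun i hi => ?_
      have hshift : x * s • a i = yy * a (i + 1) :=
        mul_smul_resolventCoeff s x yy hsryy (Finset.mem_range.mp hi)
      calc x * (s • a i * (s ^ (i + 1)) • t) = (x * s • a i) * (s ^ (i + 1)) • t := by ring
        _ = (yy * a (i + 1)) * (s ^ (i + 1)) • t := by rw [hshift]
        _ = yy * (a (i + 1) * (s ^ (i + 1)) • t) := by ring
    have h2 : ∑ i ∈ Finset.range r, a (i + 1) * (s ^ (i + 1)) • t = z + Nm ξ * t - Nm y * t := by
      have h3 := Finset.sum_range_succ' (fun j => a j * (s ^ j) • t) r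
      rw [Finset.sum_range_succ, pow_zero, one_smul] at h3
      have har : a r = Nm ξ := by
        simp only [ha, Finset.Ico_self, Finset.prod_empty, mul_one]
        exact hNx
      have ha0' : a 0 = Nm y := by
        simp only [ha, Finset.range_zero, Finset.prod_empty, one_mul, ← Finset.range_eq_Ico]
        exact hNy
      rw [har, ha0', hsr, one_smul] at h3
      have hzsum : z = ∑ j ∈ Finset.range r, a j * (s ^ j) • t := by rw [hz, hzf]
      rw [hzsum]
      linear_combination (-1 : integralClosure R L) * h3
    rw [h1, h2]
    ring
  have hfinal : (1 + ξ) * s • z - z = (x * s • z - yy * z) + y * z := by rw [hx, hyy]; ring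
  rw [hfinal, htel]
  refine Ideal.add_mem _ (Ideal.mul_mem_left _ _ (Ideal.pow_le_pow_right ?_ hδ)) ?_
  · calc m + 1 + k ≤ n + 1 + (m + 1 + C') := by omega
      _ ≤ (n + 1 + (m + 1 + C')) * r := Nat.le_mul_of_pos_right _ hrpos
  · rw [pow_add]
    exact Ideal.mul_mem_mul hy (mem_pow_of_ordIdeal_eq 𝔓 hk)

end Resolvent


/-- Residue arithmetic for Lemma 12 b): `k ≡ d j + ρ'`, `k_d ≡ d` give `k + (r-1) j k_d ≡ ρ' (mod r)`.
[folklore] -/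
theorem mod_add_pred_mul_eq {r k d j ρ' kd : ℕ} (hr : 0 < r) (hk : k % r = d * j + ρ')
    (hkd : kd % r = d) : (k + (r - 1) * j * kd) % r = ρ' % r := by
  rw [← ZMod.natCast_eq_natCast_iff']
  have h1 : ((k : ℕ) : ZMod r) = ((d * j + ρ' : ℕ) : ZMod r) := by rw [← ZMod.natCast_mod k r, hk]
  have h2 : ((kd : ℕ) : ZMod r) = ((d : ℕ) : ZMod r) := by rw [← ZMod.natCast_mod kd r, hkd]
  have h3 : (((r - 1 : ℕ)) : ZMod r) = -1 := by
    rw [Nat.cast_sub (Nat.one_le_of_lt hr), ZMod.natCast_self, Nat.cast_one, zero_sub]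
  push_cast at h1 ⊢
  rw [h3, h2, h1]
  ring

/-! ### Serre V §7, Lemmas 11–12 b): cocycles of units of exact level `m` exist (`H_m ≠ 0`) -/

section Units

variable {S : Type*} [CommRing S] [IsDedekindDomain S] (P : Ideal S) [P.IsMaximal]
  {G : Type*} [Group G] [MulSemiringAction G S]

set_option maxHeartbeats 3200000 in
/-- **Serre V §7, Lemma 12 b) (with Lemma 8), completion-free.**  Let `s` act on the Dedekind
domain `S` fixing the maximal ideal `𝔓 ≠ 0` and an element `ρ` of valuation `r > 0`, and let
`m ≥ 1`.  Suppose (Lemma 12 a)) that every class `1 + ξ`, `ξ ∈ 𝔓^m`, is a cocycle value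
modulo `U^{m+1}`: `(1 + ξ) s(z) ≡ z (mod 𝔓^{m+1+v(z)})` for some `z`.  If the residue field
`S/𝔓` is not the prime field (some class is not the class of a natural number), then some unit
`y` has `v(s y - y) = m` exactly, i.e. Serre's `H_m ≠ 0`.  Proof (Serre): otherwise the image
`ξ̄(z) ∈ 𝔓^m/𝔓^{m+1}` of a cocycle of level `≥ m` depends only on `v(z) mod r` (compare `z₁`
with `z₂ ρ^j` of the same valuation through an `S`-approximation of the local unit `z₁/z₂ρ^j`),
additively; the occurring residues `v(z) mod r` form a cyclic group, so `𝔓^m/𝔓^{m+1} ≅ S/𝔓`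
would be generated by one class `ω̄` as a **cyclic group**, i.e. every residue class would be a
natural multiple of `1` — excluded.
Ref: Serre, *Local Fields*, Ch. V §7, Lemmas 8, 11, 12 b) (p. 95: "`V_m/W_m` is cyclic, but `Ω`
is not"). [cite: SerreLocalFields1979, Ch. V §7 Lemma 12] -/
theorem exists_unit_of_forall_exists_cocycle (hP : P ≠ ⊥) {s : G} (hs : s • P = P)
    {r : ℕ} (hr : 0 < r) {ρ : S} (hρs : s • ρ = ρ) (hρ : ordIdeal P ρ = r)
    (hbig : ∃ b : S, ∀ n : ℕ, b - n ∉ P) {m : ℕ} (hm : 1 ≤ m)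
    (h12a : ∀ ξ ∈ P ^ m, ∃ (z : S) (k : ℕ), ordIdeal P z = k ∧
      (1 + ξ) * s • z - z ∈ P ^ (m + 1 + k)) :
    ∃ y : S, y ∉ P ∧ s • y - y ∈ P ^ m ∧ s • y - y ∉ P ^ (m + 1) := by
  classical
  haveI hPp : P.IsPrime := Ideal.IsMaximal.isPrime inferInstance
  by_contra hnone
  push Not at hnone
  -- (NoW) for all `y ∈ S`
  have hNoW : ∀ y : S, s • y - y ∈ P ^ m → s • y - y ∈ P ^ (m + 1) := by
    intro y hy
    by_cases hyP : y ∈ P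
    · have h1 : (1 + y) ∉ P := fun h => Ideal.IsPrime.ne_top inferInstance
        ((Ideal.eq_top_iff_one _).mpr (by simpa using P.sub_mem h hyP))
      have h2 : s • (1 + y) - (1 + y) = s • y - y := by rw [smul_add, smul_one]; ring
      have := hnone (1 + y) h1 (by rw [h2]; exact hy)
      rwa [h2] at this
    · exact hnone y hyP hy
  -- valuations of `s`-translates
  have hords : ∀ z : S, ordIdeal P (s • z) = ordIdeal P z := fun z => ordIdeal_smul hs z
  have hsmem : ∀ {z : S} {k : ℕ}, z ∈ P ^ k → s • z ∈ P ^ k := fun hz => smul_mem_pow_of_smul_eq P hs hz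
  -- (NoW) for local units `p/q`, `v(p) = v(q) = κ`
  have hNoWloc : ∀ (p q : S) (κ : ℕ), ordIdeal P q = κ → p ∈ P ^ κ →
      s • p * q - p * s • q ∈ P ^ (m + 2 * κ) → s • p * q - p * s • q ∈ P ^ (m + 1 + 2 * κ) := by
    intro p q κ hq hp h
    obtain ⟨y, hy⟩ := exists_sub_mul_mem_pow P hP hq hp (m + 1)
    have hid : s • p * q - p * s • q =
        q * s • q * (s • y - y) + (s • (p - q * y) * q - (p - q * y) * s • q) := by
      rw [smul_sub, smul_mul']; ring
    have hT : s • (p - q * y) * q - (p - q * y) * s • q ∈ P ^ (m + 1 + 2 * κ) := by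
      have e1 : s • (p - q * y) * q ∈ P ^ (κ + (m + 1) + κ) :=
        Ideal.mul_mem_mul (hsmem hy) (mem_pow_of_ordIdeal_eq P hq) |> fun h => by rwa [← pow_add] at h
      have e2 : (p - q * y) * s • q ∈ P ^ (κ + (m + 1) + κ) :=
        Ideal.mul_mem_mul hy (hsmem (mem_pow_of_ordIdeal_eq P hq)) |> fun h => by rwa [← pow_add] at h
      rw [show m + 1 + 2 * κ = κ + (m + 1) + κ by ring]
      exact Ideal.sub_mem _ e1 e2
    have hqq : ordIdeal P (q * s • q) = (2 * κ : ℕ) := by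
      rw [ordIdeal_mul hP, hords, hq]; push_cast; ring
    have h1 : q * s • q * (s • y - y) ∈ P ^ (2 * κ + m) := by
      have := Ideal.sub_mem _ h (Ideal.pow_le_pow_right (by omega) hT)
      rw [hid, add_sub_cancel_right] at this
      rwa [add_comm] at this
    have h2 : s • y - y ∈ P ^ m := mem_pow_of_mul_mem_pow_add P hP hqq h1
    have h3 := hNoW y h2
    rw [hid]
    refine Ideal.add_mem _ ?_ hT
    rw [show m + 1 + 2 * κ = 2 * κ + (m + 1) by ring, pow_add]
    exact Ideal.mul_mem_mul (mem_pow_of_ordIdeal_eq P hqq) h3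
  ------------------------------------------------------------------
  -- the image `ξ̄(z)` of a cocycle: `Im z k ξ` iff `v(z) = k`, `s z - z ≡ ξ z mod 𝔓^{m+1+k}`
  ------------------------------------------------------------------
  set Im : S → ℕ → S → Prop := fun z k ξ =>
    ordIdeal P z = k ∧ ξ ∈ P ^ m ∧ s • z - z - ξ * z ∈ P ^ (m + 1 + k) with hIm
  -- every class occurs (Lemma 12 a))
  have hocc : ∀ ξ ∈ P ^ m, ∃ z k, Im z k ξ := by
    intro ξ hξ
    obtain ⟨z, k, hk, hz⟩ := h12a (-ξ) (Submodule.neg_mem _ hξ)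
    refine ⟨z, k, hk, hξ, ?_⟩
    have hzk := mem_pow_of_ordIdeal_eq P hk
    -- `s z - z ∈ 𝔓^{m+k}` first
    have hlev : s • z - z ∈ P ^ (m + k) := by
      have h1 : (1 + -ξ) * s • z - z = (s • z - z) - ξ * s • z := by ring
      rw [h1] at hz
      have h2 : ξ * s • z ∈ P ^ (m + k) := by rw [pow_add]; exact Ideal.mul_mem_mul hξ (hsmem hzk)
      have := Ideal.add_mem _ (Ideal.pow_le_pow_right (by omega) hz) h2
      rwa [sub_add_cancel] at this
    have h3 : s • z - z - ξ * z = ((1 + -ξ) * s • z - z) + ξ * (s • z - z) := by ring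
    rw [h3]
    refine Ideal.add_mem _ hz ?_
    have : ξ * (s • z - z) ∈ P ^ (m + (m + k)) := by rw [pow_add]; exact Ideal.mul_mem_mul hξ hlev
    exact Ideal.pow_le_pow_right (by omega) this
  -- `Im` is multiplicative
  have hIm_mul : ∀ {z₁ z₂ : S} {k₁ k₂ : ℕ} {ξ₁ ξ₂ : S}, Im z₁ k₁ ξ₁ → Im z₂ k₂ ξ₂ →
      Im (z₁ * z₂) (k₁ + k₂) (ξ₁ + ξ₂) := by
    rintro z₁ z₂ k₁ k₂ ξ₁ ξ₂ ⟨hk₁, hξ₁, h₁⟩ ⟨hk₂, hξ₂, h₂⟩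
    have hz₁ := mem_pow_of_ordIdeal_eq P hk₁
    have hz₂ := mem_pow_of_ordIdeal_eq P hk₂
    refine ⟨by rw [ordIdeal_mul hP, hk₁, hk₂]; push_cast; rfl, Ideal.add_mem _ hξ₁ hξ₂, ?_⟩
    have hlev₂ : s • z₂ - z₂ ∈ P ^ (m + k₂) := by
      have : ξ₂ * z₂ ∈ P ^ (m + k₂) := by rw [pow_add]; exact Ideal.mul_mem_mul hξ₂ hz₂
      have h' := Ideal.add_mem _ (Ideal.pow_le_pow_right (by omega) h₂) this
      rwa [sub_add_cancel] at h'
    have hid : s • (z₁ * z₂) - z₁ * z₂ - (ξ₁ + ξ₂) * (z₁ * z₂) =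
        (s • z₁ - z₁ - ξ₁ * z₁) * s • z₂ + z₁ * (s • z₂ - z₂ - ξ₂ * z₂) + ξ₁ * z₁ * (s • z₂ - z₂) := by
      rw [smul_mul']; ring
    rw [hid]
    refine Ideal.add_mem _ (Ideal.add_mem _ ?_ ?_) ?_
    · have := Ideal.mul_mem_mul h₁ (hsmem hz₂)
      rwa [← pow_add, show m + 1 + k₁ + k₂ = m + 1 + (k₁ + k₂) by ring] at this
    · have := Ideal.mul_mem_mul hz₁ h₂
      rwa [← pow_add, show k₁ + (m + 1 + k₂) = m + 1 + (k₁ + k₂) by ring] at this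
    · have := Ideal.mul_mem_mul (Ideal.mul_mem_mul hξ₁ hz₁) hlev₂
      rw [← pow_add, ← pow_add] at this
      exact Ideal.pow_le_pow_right (by omega) this
  have hIm_one : Im 1 0 0 := by
    refine ⟨?_, Submodule.zero_mem _, by simp⟩
    rw [Nat.cast_zero, ordIdeal_eq_zero_iff]
    exact fun h => Ideal.IsPrime.ne_top inferInstance ((Ideal.eq_top_iff_one _).mpr h)
  have hIm_pow : ∀ {z : S} {k : ℕ} {ξ : S}, Im z k ξ → ∀ j : ℕ, Im (z ^ j) (j * k) ((j : S) * ξ) := by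
    intro z k ξ h j
    induction j with
    | zero => simpa using hIm_one
    | succ j ih =>
      have := hIm_mul ih h
      rw [pow_succ, show (j + 1 : ℕ) * k = j * k + k by ring, Nat.cast_succ, add_mul, one_mul]
      exact this
  -- scaling by the invariant `ρ^j`
  have hone : (1 : S) ∉ P := fun h => Ideal.IsPrime.ne_top inferInstance ((Ideal.eq_top_iff_one _).mpr h)
  have hρpow : ∀ j : ℕ, ordIdeal P (ρ ^ j) = ((r * j : ℕ) : ℕ∞) := by
    intro j
    induction j with
    | zero => rw [pow_zero, mul_zero, Nat.cast_zero, ordIdeal_eq_zero_iff]; exact hone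
    | succ j ih => rw [pow_succ, ordIdeal_mul hP, ih, hρ]; push_cast; ring
  have hρsj : ∀ j : ℕ, s • ρ ^ j = ρ ^ j := fun j => by rw [smul_pow', hρs]
  have hIm_rho : ∀ {z : S} {k : ℕ} {ξ : S}, Im z k ξ → ∀ j : ℕ, Im (z * ρ ^ j) (k + r * j) ξ := by
    rintro z k ξ ⟨hk, hξ, h⟩ j
    refine ⟨by rw [ordIdeal_mul hP, hk, hρpow]; push_cast; rfl, hξ, ?_⟩
    have hid : s • (z * ρ ^ j) - z * ρ ^ j - ξ * (z * ρ ^ j) = (s • z - z - ξ * z) * ρ ^ j := by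
      rw [smul_mul', hρsj]; ring
    rw [hid, show m + 1 + (k + r * j) = (m + 1 + k) + r * j by ring, pow_add]
    exact Ideal.mul_mem_mul h (mem_pow_of_ordIdeal_eq P (hρpow j))
  -- images of cocycles of the same valuation agree (mod `𝔓^{m+1}`)
  have hkey0 : ∀ {z₁ z₂ ξ₁ ξ₂ : S} {k : ℕ}, Im z₁ k ξ₁ → Im z₂ k ξ₂ → ξ₁ - ξ₂ ∈ P ^ (m + 1) := by
    rintro z₁ z₂ ξ₁ ξ₂ k ⟨hk₁, hξ₁, h₁⟩ ⟨hk₂, hξ₂, h₂⟩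
    have hz₁ := mem_pow_of_ordIdeal_eq P hk₁
    have hz₂ := mem_pow_of_ordIdeal_eq P hk₂
    have hid : s • z₁ * z₂ - z₁ * s • z₂ =
        (s • z₁ - z₁ - ξ₁ * z₁) * z₂ - z₁ * (s • z₂ - z₂ - ξ₂ * z₂) + (ξ₁ - ξ₂) * (z₁ * z₂) := by ring
    have hT1 : (s • z₁ - z₁ - ξ₁ * z₁) * z₂ ∈ P ^ (m + 1 + 2 * k) := by
      have := Ideal.mul_mem_mul h₁ hz₂; rwa [← pow_add, show m + 1 + k + k = m + 1 + 2 * k by ring] at this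
    have hT2 : z₁ * (s • z₂ - z₂ - ξ₂ * z₂) ∈ P ^ (m + 1 + 2 * k) := by
      have := Ideal.mul_mem_mul hz₁ h₂; rwa [← pow_add, show k + (m + 1 + k) = m + 1 + 2 * k by ring] at this
    have hT3 : (ξ₁ - ξ₂) * (z₁ * z₂) ∈ P ^ (m + 2 * k) := by
      have := Ideal.mul_mem_mul (Ideal.sub_mem _ hξ₁ hξ₂) (Ideal.mul_mem_mul hz₁ hz₂)
      rwa [← pow_add, ← pow_add, show m + (k + k) = m + 2 * k by ring] at this
    have hL : s • z₁ * z₂ - z₁ * s • z₂ ∈ P ^ (m + 2 * k) := by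
      rw [hid]
      exact Ideal.add_mem _ (Ideal.sub_mem _ (Ideal.pow_le_pow_right (by omega) hT1)
        (Ideal.pow_le_pow_right (by omega) hT2)) hT3
    have hL' := hNoWloc z₁ z₂ k hk₂ hz₁ hL
    have h4 : (z₁ * z₂) * (ξ₁ - ξ₂) ∈ P ^ (2 * k + (m + 1)) := by
      have : (z₁ * z₂) * (ξ₁ - ξ₂) = (s • z₁ * z₂ - z₁ * s • z₂) -
          (s • z₁ - z₁ - ξ₁ * z₁) * z₂ + z₁ * (s • z₂ - z₂ - ξ₂ * z₂) := by rw [hid]; ring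
      rw [this, show 2 * k + (m + 1) = m + 1 + 2 * k by ring]
      exact Ideal.add_mem _ (Ideal.sub_mem _ hL' hT1) hT2
    have hzz : ordIdeal P (z₁ * z₂) = ((2 * k : ℕ) : ℕ∞) := by
      rw [ordIdeal_mul hP, hk₁, hk₂]; push_cast; ring
    exact mem_pow_of_mul_mem_pow_add P hP hzz h4
  -- ... and so do images of cocycles with valuations congruent mod `r` (Lemma 8)
  have hkey : ∀ {z₁ z₂ ξ₁ ξ₂ : S} {k₁ k₂ : ℕ}, Im z₁ k₁ ξ₁ → Im z₂ k₂ ξ₂ → k₁ % r = k₂ % r →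
      ξ₁ - ξ₂ ∈ P ^ (m + 1) := by
    intro z₁ z₂ ξ₁ ξ₂ k₁ k₂ h₁ h₂ hmod
    wlog hle : k₂ ≤ k₁ generalizing z₁ z₂ ξ₁ ξ₂ k₁ k₂
    · have := this h₂ h₁ hmod.symm (le_of_not_ge hle)
      rw [← neg_sub]
      exact Submodule.neg_mem _ this
    obtain ⟨j, hj⟩ : ∃ j, k₁ = k₂ + r * j := by
      have hdvd : r ∣ k₁ - k₂ := Nat.dvd_of_mod_eq_zero (Nat.sub_mod_eq_zero_of_mod_eq hmod)
      obtain ⟨j, hj⟩ := hdvd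
      exact ⟨j, by omega⟩
    subst hj
    exact hkey0 h₁ (hIm_rho h₂ j)
  -- `𝔓^m ≠ 𝔓^{m+1}`
  have hstrict : ¬ (∀ ξ ∈ P ^ m, ξ ∈ P ^ (m + 1)) := fun h =>
    (Ideal.pow_succ_lt_pow hP m).ne (le_antisymm (Ideal.pow_le_pow_right (Nat.le_succ m)) h)
  ------------------------------------------------------------------
  -- the occurring residues `v(z) mod r` and their minimal positive element `d`
  ------------------------------------------------------------------
  by_cases hex : ∃ d, 0 < d ∧ ∃ z k ξ, Im z k ξ ∧ k % r = d
  · obtain ⟨d, hd⟩ : ∃ d, d = Nat.find hex := ⟨_, rfl⟩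
    have hspec := Nat.find_spec hex
    rw [← hd] at hspec
    obtain ⟨hdpos, zd, kd, ξd, hImd, hkd⟩ := hspec
    have hmin : ∀ d', d' < d → ∀ z k ξ, Im z k ξ → k % r = d' → d' = 0 := by
      intro d' hd' z k ξ hI hk'
      by_contra hne
      exact Nat.find_min hex (hd ▸ hd') ⟨Nat.pos_of_ne_zero hne, z, k, ξ, hI, hk'⟩
    have hdr : d < r := by rw [← hkd]; exact Nat.mod_lt _ hr
    -- every occurring residue is a multiple of `d`
    have hmult : ∀ z k ξ, Im z k ξ → k % r = d * ((k % r) / d) := by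
      intro z k ξ hI
      have hdiv := Nat.div_add_mod (k % r) d
      set j := (k % r) / d
      set ρ' := (k % r) % d with hρ'
      have hρ'd : ρ' < d := Nat.mod_lt _ hdpos
      -- `z · zd^{(r-1) j}` occurs with residue `ρ'`
      have hw := hIm_mul hI (hIm_pow hImd ((r - 1) * j))
      have hres : (k + (r - 1) * j * kd) % r = ρ' := by
        rw [mod_add_pred_mul_eq hr hdiv.symm hkd, Nat.mod_eq_of_lt (hρ'd.trans hdr)]
      have h0 := hmin ρ' hρ'd _ _ _ hw hres
      omega
    -- every class `ξ̄` is a natural multiple of `ξ̄_d`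
    have hall : ∀ ξ ∈ P ^ m, ∃ j : ℕ, ξ - (j : S) * ξd ∈ P ^ (m + 1) := by
      intro ξ hξ
      obtain ⟨z, k, hI⟩ := hocc ξ hξ
      refine ⟨(k % r) / d, hkey hI (hIm_pow hImd _) ?_⟩
      have hj := hmult z k ξ hI
      rw [Nat.mul_mod, hkd, Nat.mod_eq_of_lt (lt_of_le_of_lt (Nat.div_le_self _ _) (Nat.mod_lt _ hr)),
        mul_comm, ← hj, Nat.mod_mod]
    have hξd : ξd ∈ P ^ m := hImd.2.1
    have hξd1 : ξd ∉ P ^ (m + 1) := fun h => hstrict fun ξ hξ => by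
      obtain ⟨j, hj⟩ := hall ξ hξ
      have := Ideal.add_mem _ hj (Ideal.mul_mem_left _ (j : S) h)
      rwa [sub_add_cancel] at this
    have hω : ordIdeal P ξd = m := ordIdeal_eq_of_mem_of_not_mem P hξd hξd1
    obtain ⟨b, hb⟩ := hbig
    obtain ⟨j, hj⟩ := hall (b * ξd) (Ideal.mul_mem_left _ b hξd)
    refine hb j ?_
    have h1 : ξd * (b - j) ∈ P ^ (m + 1) := by
      rw [show ξd * (b - j) = b * ξd - (j : S) * ξd by ring]; exact hj
    have := mem_pow_of_mul_mem_pow_add P hP hω h1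
    rwa [pow_one] at this
  · push Not at hex
    refine hstrict fun ξ hξ => ?_
    obtain ⟨z, k, hI⟩ := hocc ξ hξ
    have h0 : k % r = 0 := by
      by_contra hne
      exact hex (k % r) (Nat.pos_of_ne_zero hne) z k ξ hI rfl
    have := hkey hI hIm_one (by rw [h0, Nat.zero_mod])
    rwa [sub_zero] at this

end Units

section Scaling

variable {S : Type*} [CommRing S] [IsDedekindDomain S] (P : Ideal S) [P.IsMaximal]
  {G : Type*} [Group G] [MulSemiringAction G S]

set_option maxHeartbeats 800000 in
/-- **Serre V §7, Lemma 11 (scaling), completion-free.**  If some unit `y₁` has a cocycle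
`c(y₁) = s y₁ / y₁` of exact level `m ≥ 1` (`v(s y₁ - y₁) = m`), then every class `1 + ξ`,
`ξ ∈ 𝔓^m`, is `c(y) mod U^{m+1}` for a unit `y`: `s y - y ≡ ξ y (mod 𝔓^{m+1})`.  (Serre: `H_m` is a
non-zero `k`-subspace of the line `Ω = U^m/U^{m+1}`; the scaling `y_a = 1 + a z`, `a` invariant,
`y₁ = 1 + z`.)  Residue classes are assumed to have `s`-invariant representatives.
Ref: Serre, *Local Fields*, Ch. V §7, Lemma 11. [cite: SerreLocalFields1979, Ch. V §7 Lemma 11] -/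
theorem exists_unit_cocycle_of_exists (hP : P ≠ ⊥) {s : G}
    (hfix : ∀ b : S, ∃ a : S, s • a = a ∧ b - a ∈ P) {m : ℕ}
    {y₁ : S} (hy₁P : y₁ ∉ P) (hy₁ : s • y₁ - y₁ ∈ P ^ m) (hy₁' : s • y₁ - y₁ ∉ P ^ (m + 1))
    {ξ : S} (hξ : ξ ∈ P ^ m) : ∃ y : S, y ∉ P ∧ s • y - y - ξ * y ∈ P ^ (m + 1) := by
  haveI hPp : P.IsPrime := Ideal.IsMaximal.isPrime inferInstance
  have hone : (1 : S) ∉ P := fun h => Ideal.IsPrime.ne_top inferInstance ((Ideal.eq_top_iff_one _).mpr h)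
  -- normalise `y₁ ≡ 1`: `y₂ = y₁ a₁ = 1 + z'`, `a₁` invariant
  obtain ⟨c, i, hi, hci⟩ := Ideal.IsMaximal.exists_inv inferInstance hy₁P
  obtain ⟨a₁, ha₁s, ha₁⟩ := hfix c
  set z' := y₁ * a₁ - 1 with hz'
  have hz'P : z' ∈ P := by
    have : z' = -(y₁ * (c - a₁)) - i + (c * y₁ + i - 1) := by rw [hz']; ring
    rw [this, hci, sub_self, add_zero]
    exact Ideal.sub_mem _ (Submodule.neg_mem _ (Ideal.mul_mem_left _ _ ha₁)) hi
  have ha₁P : a₁ ∉ P := fun h => hone (by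
    have : (1 : S) = y₁ * a₁ - z' := by rw [hz']; ring
    rw [this]; exact Ideal.sub_mem _ (Ideal.mul_mem_left _ _ h) hz'P)
  set δ₁ := s • z' - z' with hδ₁
  have hδ₁eq : δ₁ = a₁ * (s • y₁ - y₁) := by
    rw [hδ₁, hz', smul_sub, smul_mul', ha₁s, smul_one]; ring
  have hδ₁m : δ₁ ∈ P ^ m := by rw [hδ₁eq]; exact Ideal.mul_mem_left _ _ hy₁
  have hδ₁m' : δ₁ ∉ P ^ (m + 1) := fun h => hy₁' (by
    have ha₁0 : ordIdeal P a₁ = (0 : ℕ) := by rw [Nat.cast_zero, ordIdeal_eq_zero_iff]; exact ha₁P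
    refine mem_pow_of_mul_mem_pow_add P hP ha₁0 ?_
    rw [zero_add, ← hδ₁eq]; exact h)
  have hord : ordIdeal P δ₁ = m := ordIdeal_eq_of_mem_of_not_mem P hδ₁m hδ₁m'
  -- `ξ ≡ a₀ δ₁` with `a₀` invariant
  obtain ⟨e, he, f, hf, hef⟩ := Submodule.mem_sup.mp (pow_le_span_sup_pow_succ P hP hord hξ)
  obtain ⟨a, rfl⟩ := Ideal.mem_span_singleton'.mp he
  obtain ⟨a₀, ha₀s, ha₀⟩ := hfix a
  refine ⟨1 + a₀ * z', ?_, ?_⟩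
  · intro h
    apply hone
    have := Ideal.sub_mem _ h (Ideal.mul_mem_left _ a₀ hz'P)
    rwa [add_sub_cancel_right] at this
  have hid : s • (1 + a₀ * z') - (1 + a₀ * z') - ξ * (1 + a₀ * z') =
      -((a - a₀) * δ₁) - f - ξ * (a₀ * z') := by
    rw [← hef, smul_add, smul_one, smul_mul', ha₀s, hδ₁]; ring
  rw [hid]
  refine Ideal.sub_mem _ (Ideal.sub_mem _ (Submodule.neg_mem _ ?_) hf) ?_
  · rw [pow_succ']
    exact Ideal.mul_mem_mul ha₀ hδ₁m
  · rw [pow_succ]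
    exact Ideal.mul_mem_mul hξ (Ideal.mul_mem_left _ _ hz'P)

end Scaling

/-! ### Serre V §7, Lemma 10: above the last jump, integral `φ(m)` forces `V_m = V_{m+1}` -/

section LemmaTen

variable (R : Type*) {K L : Type*} [CommRing R] [Field K] [Field L] [Algebra R K] [Algebra R L]
  [Algebra K L] [IsScalarTower R K L]

attribute [local instance] integralClosureAlgebra integralClosure_isScalarTower_left
  integralClosure_isScalarTower_bot integralClosure_faithfulSMul integralClosure_isIntegral
  integralClosure_isTorsionFree isMaximal_under_integralClosure under_integralClosure_liesOver
  residueAlgebra residueSMul isScalarTower_residue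

variable (F : IntermediateField K L) [IsDedekindDomain R] [IsFractionRing R K]
  [FiniteDimensional K L] [IsGalois K L]
  (𝔓 : Ideal (integralClosure R L)) [𝔓.IsMaximal]

/-- `N(ž) = N(z)^{r-1}` for `ž = ∏_{σ ≠ 1} σ z` (`N = ∏_{σ ∈ Γ} σ`). [folklore] -/
theorem prod_smul_prod_erase_smul {S : Type*} [CommRing S] {G : Type*} [Group G]
    [MulSemiringAction G S] (Γ : Subgroup G) [Fintype Γ] [DecidableEq Γ] (z : S) :
    ∏ σ : Γ, (σ : G) • ∏ τ ∈ (Finset.univ : Finset Γ).erase 1, (τ : G) • z =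
      (∏ σ : Γ, (σ : G) • z) ^ (Fintype.card Γ - 1) := by
  simp only [Finset.smul_prod', smul_smul]
  rw [Finset.prod_comm]
  rw [← Finset.card_univ, ← Finset.card_erase_of_mem (Finset.mem_univ (1 : Γ)), ← Finset.prod_const]
  refine Finset.prod_congr rfl fun τ _ => ?_
  exact Fintype.prod_bijective (· * τ) (Group.mulRight_bijective τ) _ _ fun σ => rfl

set_option maxHeartbeats 1600000 in
/-- **Serre V §7, Lemma 10, completion-free.**  Let `Γ = Gal(L/F) ≤ T_𝔓` with the norm
properties, `s ∈ Γ`, and `m` with `φ(m) = n ∈ ℕ` (`S_Γ(m) = n |Γ|`) and `Γ_m = 1` (so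
`Γ_{ψ(n)} = Γ_{ψ(n)+1}`).  If the cocycle `c(z) = s z / z` lies in `U^m` (`s z - z ∈ 𝔓^{m+v(z)}`)
then it lies in `U^{m+1}`.  Proof: `c(z) = u/ν` with `ν = N(z)`, `u = s(z) ∏_{σ≠1} σ z`,
`N(u) = ν^r`; approximate the local unit `u/ν` by `y_N ∈ S` (`exists_sub_mul_mem_pow`); then
`y_N ≡ 1 (mod 𝔓^m)`, `N(y_N) ≡ 1 (mod 𝔓^{(n+1)|Γ|})`, and `NormFiltration.inj` gives
`y_N ≡ 1 (mod 𝔓^{m+1})`.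
Ref: Serre, *Local Fields*, Ch. V §7, Lemma 10 (from §6 Prop. 9 Cor. 1).
[cite: SerreLocalFields1979, Ch. V §7 Lemma 10] -/
theorem smul_sub_mem_pow_succ_of_ramificationCardSum_eq
    (hF : F.fixingSubgroup ≤ 𝔓.inertia (L ≃ₐ[K] L)) (h𝔓 : 𝔓 ≠ ⊥)
    (hNF : NormFiltration 𝔓 F.fixingSubgroup) (σ₀ : F.fixingSubgroup)
    {m n : ℕ} (hSm : ramificationCardSum 𝔓 F.fixingSubgroup m = n * Nat.card F.fixingSubgroup)
    (hΓm : 𝔓.ramificationSubgroup F.fixingSubgroup m = ⊥)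
    {z : integralClosure R L} {k : ℕ} (hk : ordIdeal 𝔓 z = k)
    (hz : (σ₀ : L ≃ₐ[K] L) • z - z ∈ 𝔓 ^ (m + k)) :
    (σ₀ : L ≃ₐ[K] L) • z - z ∈ 𝔓 ^ (m + 1 + k) := by
  classical
  haveI : IsDedekindDomain (integralClosure R L) := integralClosure.isDedekindDomain R K L
  haveI h𝔓prime : 𝔓.IsPrime := Ideal.IsMaximal.isPrime inferInstance
  obtain ⟨r, hr⟩ : ∃ r, Nat.card F.fixingSubgroup = r := ⟨_, rfl⟩
  have hrF : Fintype.card F.fixingSubgroup = r := by rw [← Nat.card_eq_fintype_card, hr]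
  have hrpos : 0 < r := by rw [← hr]; exact Nat.card_pos
  have hstab : ∀ g : F.fixingSubgroup, (g : L ≃ₐ[K] L) • 𝔓 = 𝔓 := fun g =>
    (Ideal.inertia_le_stabilizer 𝔓) (hF g.2)
  have hords : ∀ (g : F.fixingSubgroup) (w : integralClosure R L),
      ordIdeal 𝔓 ((g : L ≃ₐ[K] L) • w) = ordIdeal 𝔓 w := fun g w => ordIdeal_smul (hstab g) w
  set s : L ≃ₐ[K] L := ((σ₀ : F.fixingSubgroup) : L ≃ₐ[K] L) with hsdef
  -- `ν = N(z)`, `ž = ∏_{σ ≠ 1} σ z`, `u = s(z) ž`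
  set Nz : integralClosure R L → integralClosure R L :=
    fun w => ∏ σ : F.fixingSubgroup, (σ : L ≃ₐ[K] L) • w with hNz
  have hNfix : ∀ (g : F.fixingSubgroup) (w), (g : L ≃ₐ[K] L) • Nz w = Nz w := fun g w => by
    simp only [hNz, Finset.smul_prod', smul_smul]
    exact Fintype.prod_bijective (g * ·) (Group.mulLeft_bijective g) _ _ fun h => rfl
  have hNmul : ∀ a b, Nz (a * b) = Nz a * Nz b := fun a b => by
    simp only [hNz, smul_mul', Finset.prod_mul_distrib]
  have hNinv : ∀ a, (∀ g : F.fixingSubgroup, (g : L ≃ₐ[K] L) • a = a) → Nz a = a ^ r := fun a ha => by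
    simp only [hNz, ha, Finset.prod_const, Finset.card_univ, hrF]
  have hNord : ∀ w, ordIdeal 𝔓 (Nz w) = r * ordIdeal 𝔓 w := fun w => by
    rw [hNz]; simp only
    rw [ordIdeal_prod h𝔓, Finset.sum_congr rfl fun σ _ => hords σ w, Finset.sum_const,
      Finset.card_univ, hrF, nsmul_eq_mul]
  set ž := ∏ τ ∈ (Finset.univ : Finset F.fixingSubgroup).erase 1, (τ : L ≃ₐ[K] L) • z with hž
  set ν := Nz z with hν
  have hzž : z * ž = ν := by
    rw [hν, hNz, hž]
    simp only
    rw [← Finset.mul_prod_erase _ _ (Finset.mem_univ (1 : F.fixingSubgroup)), OneMemClass.coe_one,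
      one_smul]
  have hžord : ordIdeal 𝔓 ž = ((r - 1) * k : ℕ) := by
    rw [hž, ordIdeal_prod h𝔓, Finset.sum_congr rfl fun τ _ => by rw [hords τ z, hk],
      Finset.sum_const, Finset.card_erase_of_mem (Finset.mem_univ _), Finset.card_univ, hrF]
    push_cast; rw [nsmul_eq_mul]; push_cast; ring
  have hνord : ordIdeal 𝔓 ν = (r * k : ℕ) := by rw [hν, hNord, hk]; push_cast; rfl
  have hνfix : ∀ g : F.fixingSubgroup, (g : L ≃ₐ[K] L) • ν = ν := fun g => hNfix g z
  set u := s • z * ž with hu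
  have hrk : k + (r - 1) * k = r * k := by
    cases r with
    | zero => omega
    | succ n => rw [Nat.succ_sub_one, Nat.succ_mul]; omega
  have huord : ordIdeal 𝔓 u = (r * k : ℕ) := by
    rw [hu, ordIdeal_mul h𝔓, hords σ₀ z, hk, hžord, ← Nat.cast_add, hrk]
  have huν : u - ν ∈ 𝔓 ^ (r * k + m) := by
    have : u - ν = (s • z - z) * ž := by rw [hu, ← hzž]; ring
    rw [this, show r * k + m = (m + k) + (r - 1) * k by omega, pow_add]
    exact Ideal.mul_mem_mul hz (mem_pow_of_ordIdeal_eq 𝔓 hžord)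
  -- approximate the local unit `u/ν` by `y ∈ S`
  set N := (n + 1) * r + m + 1 with hN
  obtain ⟨y, hy⟩ := exists_sub_mul_mem_pow 𝔓 h𝔓 hνord (mem_pow_of_ordIdeal_eq 𝔓 huord) N
  have hy1 : y - 1 ∈ 𝔓 ^ m := by
    have h1 : ν * (y - 1) = (u - ν) - (u - ν * y) := by ring
    have h2 : ν * (y - 1) ∈ 𝔓 ^ (r * k + m) := by
      rw [h1]; exact Ideal.sub_mem _ huν (Ideal.pow_le_pow_right (by omega) hy)
    exact mem_pow_of_mul_mem_pow_add 𝔓 h𝔓 hνord h2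
  -- `N(u) = ν^r`, `N(ν y) = ν^r N(y)`, so `N(y) ≡ 1 (mod 𝔓^N)`
  have hNsz : Nz (s • z) = ν := by
    rw [hν, hNz]
    simp only [smul_smul]
    exact Fintype.prod_bijective (· * σ₀) (Group.mulRight_bijective σ₀) _ _ fun σ => rfl
  have hNž : Nz ž = ν ^ (r - 1) := by
    rw [hž, hν, hNz]
    simp only
    rw [prod_smul_prod_erase_smul F.fixingSubgroup z, hrF]
  have hNu : Nz u = ν ^ r := by
    rw [hu, hNmul, hNsz, hNž, ← pow_succ', Nat.sub_add_cancel hrpos]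
  have hNνy : Nz (ν * y) = ν ^ r * Nz y := by rw [hNmul, hNinv ν hνfix]
  have hdiff : Nz u - Nz (ν * y) ∈ 𝔓 ^ (r * (r * k) + N) := by
    have h := prod_sub_prod_mem_mul_pow (𝔓 ^ (r * k + N)) (𝔓 ^ (r * k))
      (Finset.univ : Finset F.fixingSubgroup)
      (fun σ => (σ : L ≃ₐ[K] L) • u) (fun σ => (σ : L ≃ₐ[K] L) • (ν * y))
      (fun σ _ => by rw [← smul_sub]; exact smul_mem_pow_of_smul_eq 𝔓 (hstab σ) hy)
      (fun σ _ => smul_mem_pow_of_smul_eq 𝔓 (hstab σ) (mem_pow_of_ordIdeal_eq 𝔓 huord))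
      (fun σ _ => smul_mem_pow_of_smul_eq 𝔓 (hstab σ)
        (Ideal.mul_mem_right _ _ (mem_pow_of_ordIdeal_eq 𝔓 hνord)))
    rw [← pow_mul, ← pow_add, Finset.card_univ, hrF] at h
    have hexp : r * k + N + r * k * (r - 1) = r * (r * k) + N := by
      cases r with
      | zero => omega
      | succ n => rw [Nat.succ_sub_one]; ring
    rw [hexp] at h
    exact h
  have hNy : Nz y - 1 ∈ 𝔓 ^ N := by
    have h1 : Nz ν * (Nz y - 1) = -(Nz u - Nz (ν * y)) := by rw [hNu, hNνy, hNinv ν hνfix]; ring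
    have h2 : Nz ν * (Nz y - 1) ∈ 𝔓 ^ (r * (r * k) + N) := by
      rw [h1]; exact Submodule.neg_mem _ hdiff
    have hνr : ordIdeal 𝔓 (Nz ν) = ((r * (r * k) : ℕ) : ℕ∞) := by
      rw [hNord, hνord]; push_cast; ring
    exact mem_pow_of_mul_mem_pow_add 𝔓 h𝔓 hνr h2
  -- `NormFiltration.inj` at `(n, m)`: `y ≡ 1 (mod 𝔓^{m+1})`
  have hprod : ∏ h : F.fixingSubgroup, (1 + (h : L ≃ₐ[K] L) • (y - 1)) = Nz y := by
    rw [hNz]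
    exact Finset.prod_congr rfl fun h _ => by rw [smul_sub, smul_one, add_sub_cancel]
  have hΓm1 : 𝔓.ramificationSubgroup F.fixingSubgroup m =
      𝔓.ramificationSubgroup F.fixingSubgroup (m + 1) := by
    rw [hΓm, eq_comm, ← le_bot_iff, ← hΓm]
    exact 𝔓.ramificationSubgroup_antitone _ (Nat.le_succ m)
  have hinj := hNF.inj n m hSm hΓm1 (y - 1) hy1 (by
    rw [hprod, hr]
    exact Ideal.pow_le_pow_right (by omega) hNy)
  -- back to `z`
  have hfin : (s • z - z) * ž ∈ 𝔓 ^ ((r - 1) * k + (m + 1 + k)) := by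
    have h1 : (s • z - z) * ž = ν * (y - 1) + (u - ν * y) := by rw [hu, ← hzž]; ring
    rw [h1, show (r - 1) * k + (m + 1 + k) = r * k + (m + 1) by omega]
    refine Ideal.add_mem _ ?_ (Ideal.pow_le_pow_right (by omega) hy)
    rw [pow_add]
    exact Ideal.mul_mem_mul (mem_pow_of_ordIdeal_eq 𝔓 hνord) hinj
  have hfin' : ž * (s • z - z) ∈ 𝔓 ^ ((r - 1) * k + (m + 1 + k)) := by
    rw [mul_comm ž (s • z - z)]; exact hfin
  exact mem_pow_of_mul_mem_pow_add 𝔓 h𝔓 hžord hfin'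

end LemmaTen

/-! ### Serre V §7, Lemma 9: deep cocycles are cocycles of elements of valuation `≡ 0 (mod r)` -/

section LemmaNine

variable (R : Type*) {K L : Type*} [CommRing R] [Field K] [Field L] [Algebra R K] [Algebra R L]
  [Algebra K L] [IsScalarTower R K L]

attribute [local instance] integralClosureAlgebra integralClosure_isScalarTower_left
  integralClosure_isScalarTower_bot integralClosure_faithfulSMul integralClosure_isIntegral
  integralClosure_isTorsionFree isMaximal_under_integralClosure under_integralClosure_liesOver
  residueAlgebra residueSMul isScalarTower_residue

variable (F : IntermediateField K L) [IsDedekindDomain R] [IsFractionRing R K]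
  [FiniteDimensional K L] [IsGalois K L]
  (𝔓 : Ideal (integralClosure R L)) [𝔓.IsMaximal]

open scoped Classical in
set_option maxHeartbeats 1600000 in
/-- **Serre V §7, Lemma 9, completion-free.**  Let `Γ = Gal(L/F) = ⟨s⟩ ≤ T_𝔓` be cyclic of
order `r`, `t₀ ∈ S` with `v(Tr t₀) = A` (`Tr = Σ_{σ ∈ Γ} σ`), and `z` with `v(z) = k` and a deep
cocycle: `s z - z ∈ 𝔓^{lev + k}`, `lev > A`.  Then `c(z) = c(q)` (`s q · z = q · s z`) for some
`q ∈ S` with `r ∣ v(q)`: with `T = Tr(z t₀)` one has `v(T) = k + A` (Serre: `y = Tr(z t)/z` is a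
principal unit), `y'' = T ∏_{σ≠1} σ z` satisfies `c(y'') = c(z)⁻¹` and `v(y'') = rk + A ≡ 0`, and
`q = ∏_{σ ≠ 1} σ y''`.  (Serre: `V_m ⊆ W` for `m > m₀`.)
Ref: Serre, *Local Fields*, Ch. V §7, Lemma 9. [cite: SerreLocalFields1979, Ch. V §7 Lemma 9] -/
theorem exists_cocycle_eq_of_deep (hF : F.fixingSubgroup ≤ 𝔓.inertia (L ≃ₐ[K] L)) (h𝔓 : 𝔓 ≠ ⊥)
    [Algebra.IsSeparable (R ⧸ 𝔓.under R) (integralClosure R L ⧸ 𝔓)]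
    {s : L ≃ₐ[K] L} (hs : Subgroup.zpowers s = F.fixingSubgroup)
    {t₀ : integralClosure R L} {A : ℕ}
    (hA : ordIdeal 𝔓 (∑ σ : F.fixingSubgroup, (σ : L ≃ₐ[K] L) • t₀) = A)
    {z : integralClosure R L} {k lev : ℕ} (hk : ordIdeal 𝔓 z = k)
    (hzlev : s • z - z ∈ 𝔓 ^ (lev + k)) (hAlev : A < lev) :
    ∃ (q : integralClosure R L) (j : ℕ), ordIdeal 𝔓 q = ((Nat.card F.fixingSubgroup * j : ℕ) : ℕ∞) ∧
      s • q * z = q * s • z := by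
  classical
  haveI : IsDedekindDomain (integralClosure R L) := integralClosure.isDedekindDomain R K L
  haveI h𝔓prime : 𝔓.IsPrime := Ideal.IsMaximal.isPrime inferInstance
  obtain ⟨r, hr⟩ : ∃ r, Nat.card F.fixingSubgroup = r := ⟨_, rfl⟩
  have hrF : Fintype.card F.fixingSubgroup = r := by rw [← Nat.card_eq_fintype_card, hr]
  have hrpos : 0 < r := by rw [← hr]; exact Nat.card_pos
  rw [hr]
  have hstab : ∀ g : F.fixingSubgroup, (g : L ≃ₐ[K] L) • 𝔓 = 𝔓 := fun g =>
    (Ideal.inertia_le_stabilizer 𝔓) (hF g.2)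
  have hords : ∀ (g : F.fixingSubgroup) (w : integralClosure R L),
      ordIdeal 𝔓 ((g : L ≃ₐ[K] L) • w) = ordIdeal 𝔓 w := fun g w => ordIdeal_smul (hstab g) w
  have hsΓ : s ∈ F.fixingSubgroup := hs ▸ Subgroup.mem_zpowers s
  set σ₀ : F.fixingSubgroup := ⟨s, hsΓ⟩ with hσ₀
  have hσ₀s : ((σ₀ : F.fixingSubgroup) : L ≃ₐ[K] L) = s := rfl
  have hspow : ∀ l : ℕ, s ^ l ∈ F.fixingSubgroup := fun l => Subgroup.pow_mem _ hsΓ l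
  have hstabl : ∀ l : ℕ, (s ^ l) • 𝔓 = 𝔓 := fun l => hstab ⟨s ^ l, hspow l⟩
  obtain ⟨e, he⟩ := exists_fin_equiv_pow hs
  -- invariant sums and products
  have hsumfix : ∀ (g : F.fixingSubgroup) (f : integralClosure R L),
      (g : L ≃ₐ[K] L) • ∑ σ : F.fixingSubgroup, (σ : L ≃ₐ[K] L) • f =
        ∑ σ : F.fixingSubgroup, (σ : L ≃ₐ[K] L) • f := fun g f => by
    simp only [Finset.smul_sum, smul_smul]
    exact Fintype.sum_bijective (g * ·) (Group.mulLeft_bijective g) _ _ fun h => rfl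
  have hprodfix : ∀ (g : F.fixingSubgroup) (f : integralClosure R L),
      (g : L ≃ₐ[K] L) • ∏ σ : F.fixingSubgroup, (σ : L ≃ₐ[K] L) • f =
        ∏ σ : F.fixingSubgroup, (σ : L ≃ₐ[K] L) • f := fun g f => by
    simp only [Finset.smul_prod', smul_smul]
    exact Fintype.prod_bijective (g * ·) (Group.mulLeft_bijective g) _ _ fun h => rfl
  set a₀ := ∑ σ : F.fixingSubgroup, (σ : L ≃ₐ[K] L) • t₀ with ha₀
  have hrA : r ∣ A := by
    rw [← hrF]
    exact card_dvd_of_invariant_of_ordIdeal_eq R F 𝔓 h𝔓 hF (fun γ => hsumfix γ t₀) hA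
  -- `s^i z ≡ z (mod 𝔓^{lev+k})`
  have hpow : ∀ i : ℕ, (s ^ i) • z - z ∈ 𝔓 ^ (lev + k) := by
    intro i
    induction i with
    | zero => simp
    | succ i ih =>
      have : (s ^ (i + 1)) • z - z = s • ((s ^ i) • z - z) + (s • z - z) := by
        rw [pow_succ', mul_smul, smul_sub]; ring
      rw [this]
      exact Ideal.add_mem _ (smul_mem_pow_of_smul_eq 𝔓 (hstab σ₀) ih) hzlev
  -- `T = Tr(z t₀) = z a₀ + E`, `E ∈ 𝔓^{lev+k}`
  set T := ∑ σ : F.fixingSubgroup, (σ : L ≃ₐ[K] L) • (z * t₀) with hT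
  have hTE : T = z * a₀ + ∑ σ : F.fixingSubgroup, ((σ : L ≃ₐ[K] L) • z - z) * (σ : L ≃ₐ[K] L) • t₀ := by
    rw [hT, ha₀, Finset.mul_sum, ← Finset.sum_add_distrib]
    exact Finset.sum_congr rfl fun σ _ => by rw [smul_mul']; ring
  have hE : ∑ σ : F.fixingSubgroup, ((σ : L ≃ₐ[K] L) • z - z) * (σ : L ≃ₐ[K] L) • t₀ ∈
      𝔓 ^ (lev + k) := by
    rw [← sum_range_pow_smul_eq e he (fun g => (g • z - z) * g • t₀)]
    exact Ideal.sum_mem _ fun i _ => Ideal.mul_mem_right _ _ (hpow i)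
  have hza₀ : ordIdeal 𝔓 (z * a₀) = ((k + A : ℕ) : ℕ∞) := by
    rw [ordIdeal_mul h𝔓, hk, hA]; push_cast; rfl
  have hTord : ordIdeal 𝔓 T = ((k + A : ℕ) : ℕ∞) := by
    refine ordIdeal_eq_of_mem_of_not_mem 𝔓 ?_ fun h => ?_
    · rw [hTE]
      exact Ideal.add_mem _ (mem_pow_of_ordIdeal_eq 𝔓 hza₀) (Ideal.pow_le_pow_right (by omega) hE)
    · refine not_mem_pow_succ_of_ordIdeal_eq 𝔓 hza₀ ?_
      have : z * a₀ = T - ∑ σ : F.fixingSubgroup,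
          ((σ : L ≃ₐ[K] L) • z - z) * (σ : L ≃ₐ[K] L) • t₀ := by rw [hTE]; ring
      rw [this]
      exact Ideal.sub_mem _ h (Ideal.pow_le_pow_right (by omega) hE)
  have hTfix : s • T = T := hsumfix σ₀ (z * t₀)
  -- `ž`, `ν = N z`, `y'' = T ž`, `q = ∏_{σ≠1} σ y''`
  set ž := ∏ τ ∈ (Finset.univ : Finset F.fixingSubgroup).erase 1, (τ : L ≃ₐ[K] L) • z with hž
  set ν := ∏ τ : F.fixingSubgroup, (τ : L ≃ₐ[K] L) • z with hν
  have hzž : z * ž = ν := by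
    rw [hν, hž, ← Finset.mul_prod_erase _ _ (Finset.mem_univ (1 : F.fixingSubgroup)),
      OneMemClass.coe_one, one_smul]
  have hνfix : s • ν = ν := hprodfix σ₀ z
  have hžord : ordIdeal 𝔓 ž = (((r - 1) * k : ℕ) : ℕ∞) := by
    rw [hž, ordIdeal_prod h𝔓, Finset.sum_congr rfl fun τ _ => by rw [hords τ z, hk],
      Finset.sum_const, Finset.card_erase_of_mem (Finset.mem_univ _), Finset.card_univ, hrF]
    push_cast; rw [nsmul_eq_mul]; push_cast; ring
  set y'' := T * ž with hy''
  have hy''ord : ordIdeal 𝔓 y'' = ((k + A + (r - 1) * k : ℕ) : ℕ∞) := by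
    rw [hy'', ordIdeal_mul h𝔓, hTord, hžord]; push_cast; ring
  have hrel1 : s • y'' * s • z = y'' * z := by
    have h1 : s • y'' * s • z = T * s • (z * ž) := by
      rw [hy'', smul_mul', hTfix, smul_mul']; ring
    rw [h1, hzž, hνfix, ← hzž, hy'']; ring
  set q := ∏ τ ∈ (Finset.univ : Finset F.fixingSubgroup).erase 1, (τ : L ≃ₐ[K] L) • y'' with hq
  have hqy : q * y'' = ∏ τ : F.fixingSubgroup, (τ : L ≃ₐ[K] L) • y'' := by
    rw [hq, mul_comm, ← Finset.mul_prod_erase _ _ (Finset.mem_univ (1 : F.fixingSubgroup)),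
      OneMemClass.coe_one, one_smul]
  have hrel2 : s • q * s • y'' = q * y'' := by
    rw [← smul_mul', hqy]
    exact hprodfix σ₀ y''
  have hy''0 : s • y'' ≠ 0 := by
    intro h0
    have hy0 : y'' = 0 := by
      have := congrArg (s⁻¹ • ·) h0
      simpa only [smul_smul, inv_mul_cancel, one_smul, smul_zero] using this
    have := not_mem_pow_succ_of_ordIdeal_eq 𝔓 hy''ord
    rw [hy0] at this
    exact this (Submodule.zero_mem _)
  refine ⟨q, (r - 1) * (k + A / r), ?_, ?_⟩
  · rw [hq, ordIdeal_prod h𝔓, Finset.sum_congr rfl fun τ _ => by rw [hords τ y'', hy''ord],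
      Finset.sum_const, Finset.card_erase_of_mem (Finset.mem_univ _), Finset.card_univ, hrF,
      nsmul_eq_mul]
    obtain ⟨a, ha⟩ := hrA
    subst ha
    rw [Nat.mul_div_cancel_left a hrpos]
    push_cast
    have hr1 : ((r - 1 : ℕ) : ℕ∞) = (r : ℕ∞) - 1 := by
      rw [ENat.coe_sub, Nat.cast_one]
    have key : ((r - 1 : ℕ) : ℕ) * (k + r * a + (r - 1) * k) = r * ((r - 1) * (k + a)) := by
      cases r with
      | zero => omega
      | succ n => simp only [Nat.succ_sub_one]; ring
    exact_mod_cast congrArg (fun n : ℕ => (n : ℕ∞)) key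
  · have h : (s • q * z - q * s • z) * s • y'' = 0 := by
      have : (s • q * z - q * s • z) * s • y'' = (s • q * s • y'') * z - q * (s • y'' * s • z) := by
        ring
      rw [this, hrel2, hrel1]; ring
    rcases mul_eq_zero.mp h with h1 | h1
    · exact sub_eq_zero.mp h1
    · exact absurd h1 hy''0

end LemmaNine

/-! ### Serre V §7, Prop. 11 (in `S_H`-form): `|H| ∣ S_H(μ)` for the last jump `μ` of a cyclic `H ≤ T_𝔓` -/

section Main

variable {R : Type*} {K L : Type*} [CommRing R] [Field K] [Field L] [Algebra R K] [Algebra R L]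
  [Algebra K L] [IsScalarTower R K L]

attribute [local instance] integralClosureAlgebra integralClosure_isScalarTower_left
  integralClosure_isScalarTower_bot integralClosure_faithfulSMul integralClosure_isIntegral
  integralClosure_isTorsionFree isMaximal_under_integralClosure under_integralClosure_liesOver
  residueAlgebra residueSMul isScalarTower_residue

variable [IsDedekindDomain R] [IsFractionRing R K] [FiniteDimensional K L] [IsGalois K L]

/-- `c(y)⁻¹`-bookkeeping: for `yc = ∏_{τ ≠ 1} τ y`, `y · yc = N(y)`. [folklore] -/
theorem mul_prod_erase_one_smul {S : Type*} [CommRing S] {G : Type*} [Group G]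
    [MulSemiringAction G S] (Γ : Subgroup G) [Fintype Γ] [DecidableEq Γ] (y : S) :
    y * ∏ τ ∈ (Finset.univ : Finset Γ).erase 1, (τ : G) • y = ∏ τ : Γ, (τ : G) • y := by
  rw [← Finset.mul_prod_erase _ _ (Finset.mem_univ (1 : Γ)), OneMemClass.coe_one, one_smul]

set_option maxHeartbeats 6400000 in
/-- **Serre V §7, Proposition 11 (the cyclic core of Hasse–Arf), completion-free, `S_H`-form.**
Let `R` be Dedekind with fraction field `K`, `L/K` finite abelian, `𝔓 ≠ 0` a maximal ideal of
`S = integralClosure R L` with separable residue extension **whose residue field is not the prime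
field** (some residue class is not the class of a natural number), `H ≤ T_𝔓` cyclic, and `μ` the
last jump of `H` (`H_μ ≠ 1`, `H_{μ+1} = 1`).  Then `|H| ∣ S_H(μ) = Σ_{i=1}^{μ} |H_i|`, i.e.
`φ_H(μ) ∈ ℤ`.  Proof (Serre, Lemmas 8–13, in the cocycle language of this file): if not, start
from `z₀ = ∏_{l<k} s^l π` (`c(z₀) = c_{s^k}(π)`, `s^k ∈ H_μ ∖ 1`, `0 < k < r`, level `μ`) and
climb: at a level `m ≥ μ` with `r ∣ S_H(m)` (so `m > μ`) Lemma 10 raises the level for free; at a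
level with `r ∤ S_H(m)` Lemmas 12 a), 12 b), 11 give a unit `y` with `c(y) ≡ c(z) (mod U^{m+1})`,
and `z ↦ z ∏_{σ≠1} σ y` raises the level keeping `v(z) = k` and `c(z₀) ∈ c(z) W`; above the level
`m₀ = v(Tr t₀)` Lemma 9 gives `c(z) = c(q)` with `r ∣ v(q)`, so `z₀ ∏_{σ≠1} σ(q u)` is
`H`-invariant of valuation `≡ k (mod r)`, contradicting Lemma 8 (`r ∣ v` on invariants).
Ref: Serre, *Local Fields*, Ch. V §7, Prop. 11 and Lemmas 8–13 (pp. 93–96).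
[cite: SerreLocalFields1979, Ch. V §7 Prop. 11] -/
theorem card_dvd_ramificationCardSum_of_exists_sub_natCast_notMem
    [IsMulCommutative (L ≃ₐ[K] L)] (𝔓 : Ideal (integralClosure R L)) [𝔓.IsMaximal] (h𝔓 : 𝔓 ≠ ⊥)
    [Algebra.IsSeparable (R ⧸ 𝔓.under R) (integralClosure R L ⧸ 𝔓)]
    (H : Subgroup (L ≃ₐ[K] L)) [IsCyclic H] (hH : H ≤ 𝔓.inertia (L ≃ₐ[K] L))
    (hbig : ∃ b : integralClosure R L, ∀ n : ℕ, b - n ∉ 𝔓) {μ : ℕ}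
    (hμ : 𝔓.ramificationSubgroup H μ ≠ ⊥) (hμ1 : 𝔓.ramificationSubgroup H (μ + 1) = ⊥) :
    Nat.card H ∣ ramificationCardSum 𝔓 H μ := by
  classical
  rcases Nat.eq_zero_or_pos μ with rfl | hμpos
  · simp
  by_contra hndvd
  obtain ⟨F, rfl⟩ : ∃ F : IntermediateField K L, F.fixingSubgroup = H :=
    ⟨IntermediateField.fixedField H, IntermediateField.fixingSubgroup_fixedField H⟩
  haveI : IsDedekindDomain (integralClosure R L) := integralClosure.isDedekindDomain R K L
  haveI h𝔓prime : 𝔓.IsPrime := Ideal.IsMaximal.isPrime inferInstance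
  have hone : (1 : integralClosure R L) ∉ 𝔓 := fun h =>
    Ideal.IsPrime.ne_top inferInstance ((Ideal.eq_top_iff_one _).mpr h)
  obtain ⟨r, hr⟩ : ∃ r, Nat.card F.fixingSubgroup = r := ⟨_, rfl⟩
  have hrF : Fintype.card F.fixingSubgroup = r := by rw [← Nat.card_eq_fintype_card, hr]
  have hrpos : 0 < r := by rw [← hr]; exact Nat.card_pos
  rw [hr] at hndvd
  have hstab : ∀ g : F.fixingSubgroup, (g : L ≃ₐ[K] L) • 𝔓 = 𝔓 := fun g =>
    (Ideal.inertia_le_stabilizer 𝔓) (hH g.2)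
  have hords : ∀ (g : F.fixingSubgroup) (w : integralClosure R L),
      ordIdeal 𝔓 ((g : L ≃ₐ[K] L) • w) = ordIdeal 𝔓 w := fun g w => ordIdeal_smul (hstab g) w
  have hprodfix : ∀ (g : F.fixingSubgroup) (f : integralClosure R L),
      (g : L ≃ₐ[K] L) • ∏ σ : F.fixingSubgroup, (σ : L ≃ₐ[K] L) • f =
        ∏ σ : F.fixingSubgroup, (σ : L ≃ₐ[K] L) • f := fun g f => by
    simp only [Finset.smul_prod', smul_smul]
    exact Fintype.prod_bijective (g * ·) (Group.mulLeft_bijective g) _ _ fun h => rfl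
  have hnotmem_prod : ∀ f : integralClosure R L, f ∉ 𝔓 →
      ∏ τ ∈ (Finset.univ : Finset F.fixingSubgroup).erase 1, (τ : L ≃ₐ[K] L) • f ∉ 𝔓 := by
    intro f hf
    refine Finset.prod_induction _ (fun b => b ∉ 𝔓) (fun b₁ b₂ h₁ h₂ h₁₂ =>
      (Ideal.IsPrime.mem_or_mem inferInstance h₁₂).elim h₁ h₂) hone fun τ _ hτf => hf ?_
    have h1 : (τ : L ≃ₐ[K] L) • f ∈ 𝔓 ^ 1 := by rw [pow_one]; exact hτf
    have h2 := smul_mem_pow_of_smul_eq 𝔓 (hstab τ⁻¹) h1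
    rwa [pow_one, Subgroup.coe_inv, smul_smul, inv_mul_cancel, one_smul] at h2
  ------------------------------------------------------------------
  -- a generator `s`, the norm properties, a uniformizer `π`, invariant residue representatives
  ------------------------------------------------------------------
  obtain ⟨g, hg⟩ := IsCyclic.exists_generator (α := F.fixingSubgroup)
  set s : L ≃ₐ[K] L := (g : L ≃ₐ[K] L) with hsdef
  have hsΓ : s ∈ F.fixingSubgroup := g.2
  have hs : Subgroup.zpowers s = F.fixingSubgroup := by
    refine le_antisymm ((Subgroup.zpowers_le).mpr hsΓ) fun x hx => ?_
    obtain ⟨i, hi⟩ := Subgroup.mem_zpowers_iff.mp (hg ⟨x, hx⟩)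
    exact Subgroup.mem_zpowers_iff.mpr ⟨i, by
      have := congrArg Subtype.val hi
      simpa only [SubgroupClass.coe_zpow] using this⟩
  set σ₀ : F.fixingSubgroup := ⟨s, hsΓ⟩ with hσ₀
  have hstabs : s • 𝔓 = 𝔓 := hstab σ₀
  have hspow : ∀ l : ℕ, s ^ l ∈ F.fixingSubgroup := fun l => Subgroup.pow_mem _ hsΓ l
  have hstabl : ∀ l : ℕ, (s ^ l) • 𝔓 = 𝔓 := fun l => hstab ⟨s ^ l, hspow l⟩
  obtain ⟨e, he⟩ := exists_fin_equiv_pow hs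
  have hNF : NormFiltration 𝔓 F.fixingSubgroup := normFiltration 𝔓 h𝔓 F.fixingSubgroup hH
  obtain ⟨π, hπ1, hπ2⟩ := SetLike.exists_of_lt (Ideal.pow_succ_lt_pow h𝔓 1)
  have hπ : π ∈ 𝔓 := by rwa [pow_one] at hπ1
  have hπord : ordIdeal 𝔓 π = (1 : ℕ) := ordIdeal_eq_of_mem_of_not_mem 𝔓 hπ1 hπ2
  have hfix : ∀ γ : L ≃ₐ[K] L, γ ∈ 𝔓.inertia (L ≃ₐ[K] L) →
      ∀ b : integralClosure R L, ∃ a, γ • a = a ∧ b - a ∈ 𝔓 := by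
    intro γ hγ b
    obtain ⟨a, ha, hb⟩ := exists_inertia_fixed_sub_mem (L ≃ₐ[K] L) (𝔓.under R) 𝔓 b
    exact ⟨a, ha γ hγ, hb⟩
  have hcrit : ∀ (γ : F.fixingSubgroup) (i : ℕ), (γ : L ≃ₐ[K] L) • π - π ∈ 𝔓 ^ (i + 1) →
      γ ∈ 𝔓.ramificationSubgroup F.fixingSubgroup i := fun γ i h =>
    (mem_ramificationSubgroup_subgroup_iff 𝔓 F.fixingSubgroup).mpr
      ((mem_ramificationSubgroup_iff_smul_sub_mem_pow 𝔓 h𝔓 (hstab γ) (hfix γ (hH γ.2)) hπ hπ2 i).mpr h)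
  have hx₀ : ∀ γ : F.fixingSubgroup, γ ≠ 1 → (γ : L ≃ₐ[K] L) • π - π ∉ 𝔓 ^ (μ + 1 + 1) := by
    intro γ hne h
    have hmem := hcrit γ (μ + 1) h
    rw [hμ1, Subgroup.mem_bot] at hmem
    exact hne hmem
  -- `ρ = N(π)`, invariant of valuation `r`
  set ρ := ∏ h : F.fixingSubgroup, (h : L ≃ₐ[K] L) • π with hρ
  have hρs : s • ρ = ρ := hprodfix σ₀ π
  have hρord : ordIdeal 𝔓 ρ = r := by
    rw [hρ, ordIdeal_prod h𝔓, Finset.sum_congr rfl fun τ _ => by rw [hords τ π, hπord],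
      Finset.sum_const, Finset.card_univ, hrF, nsmul_eq_mul, Nat.cast_one, mul_one]
  ------------------------------------------------------------------
  -- `τ = s^{k₀} ∈ H_μ ∖ 1`, `0 < k₀ < r`, and `z₀ = ∏_{l<k₀} s^l π`
  ------------------------------------------------------------------
  obtain ⟨τ, hτ1⟩ := (Subgroup.ne_bot_iff_exists_ne_one).mp hμ
  have hτμ : (τ : F.fixingSubgroup) ∈ 𝔓.ramificationSubgroup F.fixingSubgroup μ := τ.2
  have hτne : (τ : F.fixingSubgroup) ≠ 1 := fun h => hτ1 (Subtype.ext h)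
  obtain ⟨k₀, hk₀r, hk₀⟩ : ∃ k₀, k₀ < r ∧ s ^ k₀ = ((τ : F.fixingSubgroup) : L ≃ₐ[K] L) := by
    obtain ⟨i, hi⟩ := e.surjective (τ : F.fixingSubgroup)
    exact ⟨i, hrF ▸ i.2, by rw [← he i, hi]⟩
  have hk₀pos : 0 < k₀ := by
    rcases Nat.eq_zero_or_pos k₀ with h | h
    · exact absurd (Subtype.ext (by rw [← hk₀, h, pow_zero]; rfl)) hτne
    · exact h
  set z₀ := ∏ l ∈ Finset.range k₀, (s ^ l) • π with hz₀
  have hz₀ord : ordIdeal 𝔓 z₀ = (k₀ : ℕ) := by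
    rw [hz₀, ordIdeal_prod h𝔓, Finset.sum_congr rfl fun l _ => by
      rw [ordIdeal_smul (hstabl l) π, hπord], Finset.sum_const, Finset.card_range, nsmul_eq_mul,
      Nat.cast_one, mul_one]
  have hz₀rel : s • z₀ * π = z₀ * (s ^ k₀) • π := by
    have h1 := Finset.prod_range_succ' (fun l => (s ^ l) • π) k₀
    have h2 := Finset.prod_range_succ (fun l => (s ^ l) • π) k₀
    simp only [pow_zero, one_smul] at h1
    rw [hz₀, Finset.smul_prod']
    simp only [smul_smul, ← pow_succ']
    rw [← h1, h2]
  have hz₀lev : s • z₀ - z₀ ∈ 𝔓 ^ (μ + 0 + k₀) := by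
    have h1 : π * (s • z₀ - z₀) = z₀ * ((s ^ k₀) • π - π) := by
      rw [mul_sub, mul_comm π (s • z₀), hz₀rel]; ring
    have h2 : (s ^ k₀) • π - π ∈ 𝔓 ^ (μ + 1) := by
      rw [hk₀]
      exact ((Ideal.mem_ramificationSubgroup_iff).mp
        ((mem_ramificationSubgroup_subgroup_iff 𝔓 F.fixingSubgroup).mp hτμ)).2 π
    have h3 : π * (s • z₀ - z₀) ∈ 𝔓 ^ (1 + (μ + 0 + k₀)) := by
      rw [h1, show 1 + (μ + 0 + k₀) = k₀ + (μ + 1) by omega, pow_add]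
      exact Ideal.mul_mem_mul (mem_pow_of_ordIdeal_eq 𝔓 hz₀ord) h2
    exact mem_pow_of_mul_mem_pow_add 𝔓 h𝔓 hπord h3
  ------------------------------------------------------------------
  -- `t₀` with `v(Tr t₀) = A ≤ (r-1)(μ+2)` (approximate independence with all coefficients `1`)
  ------------------------------------------------------------------
  obtain ⟨t₀, A, hA, -⟩ : ∃ (t₀ : integralClosure R L) (A : ℕ),
      ordIdeal 𝔓 (∑ σ : F.fixingSubgroup, (σ : L ≃ₐ[K] L) • t₀) = A ∧ A ≤ (r - 1) * (μ + 1 + 1) := by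
    by_contra hnone
    push Not at hnone
    have hall : ∀ t : integralClosure R L, ∑ σ ∈ (Finset.univ : Finset F.fixingSubgroup),
        (1 : integralClosure R L) * (σ : L ≃ₐ[K] L) • t ∈
        𝔓 ^ (1 + ((Finset.univ : Finset F.fixingSubgroup).card - 1) * (μ + 1 + 1)) := by
      intro t
      simp only [one_mul, Finset.card_univ, hrF]
      rw [← le_ordIdeal_iff_mem_pow]
      induction h : ordIdeal 𝔓 (∑ σ : F.fixingSubgroup, (σ : L ≃ₐ[K] L) • t) using ENat.recTopCoe with
      | top => exact le_top
      | coe A => rw [add_comm]; exact_mod_cast Nat.succ_le_of_lt (hnone t A h)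
    have h1 := mem_pow_of_forall_sum_mul_smul_mem_pow R F 𝔓 hH h𝔓 π hx₀ Finset.univ (fun _ => 1)
      1 hall 1 (Finset.mem_univ _)
    rw [pow_one] at h1
    exact hone h1
  ------------------------------------------------------------------
  -- the descent (Lemma 13 with Lemmas 10, 11, 12)
  ------------------------------------------------------------------
  have hdesc : ∀ i : ℕ, ∃ z u : integralClosure R L, ordIdeal 𝔓 z = (k₀ : ℕ) ∧ u ∉ 𝔓 ∧
      s • z - z ∈ 𝔓 ^ (μ + i + k₀) ∧ s • z₀ * (z * u) = z₀ * s • (z * u) := by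
    intro i
    induction i with
    | zero => exact ⟨z₀, 1, hz₀ord, hone, hz₀lev, by rw [mul_one]; exact mul_comm _ _⟩
    | succ i ih =>
      obtain ⟨z, u, hzk, hu, hzlev, hrel⟩ := ih
      by_cases hdvd : r ∣ ramificationCardSum 𝔓 F.fixingSubgroup (μ + i)
      · -- `φ(m) ∈ ℤ`: then `m > μ` and Lemma 10 applies
        have hi : 0 < i := by
          rcases Nat.eq_zero_or_pos i with h0 | h0
          · rw [h0, add_zero] at hdvd; exact absurd hdvd hndvd
          · exact h0
        obtain ⟨n, hn⟩ := hdvd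
        have hΓm : 𝔓.ramificationSubgroup F.fixingSubgroup (μ + i) = ⊥ :=
          le_bot_iff.mp (hμ1 ▸ 𝔓.ramificationSubgroup_antitone _ (by omega))
        have h10 := smul_sub_mem_pow_succ_of_ramificationCardSum_eq R F 𝔓 hH h𝔓 hNF σ₀ (n := n)
          (by rw [hn, hr, mul_comm]) hΓm hzk hzlev
        refine ⟨z, u, hzk, hu, ?_, hrel⟩
        rw [show μ + (i + 1) + k₀ = μ + i + 1 + k₀ by ring]
        exact h10
      · -- `φ(m) ∉ ℤ`: Lemmas 12 a), 12 b), 11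
        set m := μ + i with hm
        set n := ramificationCardSum 𝔓 F.fixingSubgroup m / r with hn
        have hdm := Nat.div_add_mod (ramificationCardSum 𝔓 F.fixingSubgroup m) r
        rw [← hn] at hdm
        have hmod := Nat.mod_lt (ramificationCardSum 𝔓 F.fixingSubgroup m) hrpos
        have hmod0 : ramificationCardSum 𝔓 F.fixingSubgroup m % r ≠ 0 := fun h0 =>
          hdvd (Nat.dvd_of_mod_eq_zero h0)
        have hcomm : n * r = r * n := mul_comm n r
        have hmn : n * Nat.card F.fixingSubgroup < ramificationCardSum 𝔓 F.fixingSubgroup m := by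
          rw [hr]; omega
        have hmn' : ramificationCardSum 𝔓 F.fixingSubgroup m < (n + 1) * Nat.card F.fixingSubgroup := by
          rw [hr, add_mul, one_mul]; omega
        have hbot : 𝔓.ramificationSubgroup F.fixingSubgroup (m + 1) = ⊥ :=
          le_bot_iff.mp (hμ1 ▸ 𝔓.ramificationSubgroup_antitone _ (by omega))
        have h12a : ∀ ξ ∈ 𝔓 ^ m, ∃ (z' : integralClosure R L) (k : ℕ), ordIdeal 𝔓 z' = k ∧
            (1 + ξ) * s • z' - z' ∈ 𝔓 ^ (m + 1 + k) := fun ξ hξ => by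
          obtain ⟨z', k, hk, -, h⟩ := exists_resolvent R F 𝔓 hH h𝔓 hNF hs π hx₀ hmn hmn' hbot hξ
          exact ⟨z', k, hk, h⟩
        have hm1 : 1 ≤ m := le_trans hμpos (Nat.le_add_right μ i)
        obtain ⟨y₁, hy₁P, hy₁, hy₁'⟩ :=
          exists_unit_of_forall_exists_cocycle 𝔓 h𝔓 hstabs hrpos hρs hρord hbig hm1 h12a
        -- the class of `c(z)`: `s z - z = z ξ + e'`
        have hzlev' : s • z - z ∈ 𝔓 ^ (k₀ + m) := by rwa [add_comm] at hzlev
        obtain ⟨w₁, hw₁, e', he', hwe⟩ :=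
          Submodule.mem_sup.mp (pow_add_le_span_mul_pow_sup 𝔓 h𝔓 hzk m hzlev')
        obtain ⟨ξ, hξ, rfl⟩ := Ideal.mem_span_singleton_mul.mp hw₁
        obtain ⟨y, hyP, hy⟩ :=
          exists_unit_cocycle_of_exists 𝔓 h𝔓 (hfix s (hH hsΓ)) hy₁P hy₁ hy₁' hξ
        -- `z ↦ z yc`, `u ↦ u y`
        set yc := ∏ τ ∈ (Finset.univ : Finset F.fixingSubgroup).erase 1, (τ : L ≃ₐ[K] L) • y with hyc
        set η := ∏ τ : F.fixingSubgroup, (τ : L ≃ₐ[K] L) • y with hη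
        have hyyc : y * yc = η := mul_prod_erase_one_smul F.fixingSubgroup y
        have hηs : s • η = η := hprodfix σ₀ y
        have hycP : yc ∉ 𝔓 := hnotmem_prod y hyP
        have hsyP : s • y ∉ 𝔓 := fun h => hyP (by
          have h1 : s • y ∈ 𝔓 ^ 1 := by rw [pow_one]; exact h
          have h2 := smul_mem_pow_of_smul_eq 𝔓 (hstab σ₀⁻¹) h1
          rwa [pow_one, Subgroup.coe_inv, smul_smul, inv_mul_cancel, one_smul] at h2)
        refine ⟨z * yc, u * y, ?_, ?_, ?_, ?_⟩
        · rw [ordIdeal_mul h𝔓, hzk, (ordIdeal_eq_zero_iff).mpr hycP, add_zero]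
        · exact fun h => (Ideal.IsPrime.mem_or_mem inferInstance h).elim hu hyP
        · -- `(s(z yc) - z yc) s(y) = yc (e' y - z e_y)`
          have hey : s • y - y - ξ * y ∈ 𝔓 ^ (m + 1) := hy
          have key : (s • (z * yc) - z * yc) * s • y = yc * (e' * y - z * (s • y - y - ξ * y)) := by
            have h1 : s • (z * yc) * s • y = s • z * (s • (y * yc)) := by
              rw [smul_mul', smul_mul']; ring
            have h2 : s • z = z + z * ξ + e' := by rw [add_assoc, hwe]; ring
            rw [sub_mul, h1, hyyc, hηs, ← hyyc, h2]; ring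
          have hmem : s • y * (s • (z * yc) - z * yc) ∈ 𝔓 ^ (0 + (μ + (i + 1) + k₀)) := by
            rw [mul_comm, key, zero_add, show μ + (i + 1) + k₀ = k₀ + m + 1 by rw [hm]; ring]
            refine Ideal.mul_mem_left _ _ (Ideal.sub_mem _ (Ideal.mul_mem_right _ _ he') ?_)
            rw [show k₀ + m + 1 = k₀ + (m + 1) by ring, pow_add]
            exact Ideal.mul_mem_mul (mem_pow_of_ordIdeal_eq 𝔓 hzk) hey
          exact mem_pow_of_mul_mem_pow_add 𝔓 h𝔓
            ((ordIdeal_eq_zero_iff).mpr hsyP : ordIdeal 𝔓 (s • y) = (0 : ℕ)) hmem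
        · have h1 : z * yc * (u * y) = (z * u) * η := by rw [← hyyc]; ring
          rw [h1, smul_mul', hηs]
          calc s • z₀ * (z * u * η) = (s • z₀ * (z * u)) * η := by ring
            _ = (z₀ * s • (z * u)) * η := by rw [hrel]
            _ = z₀ * (s • (z * u) * η) := by ring
  ------------------------------------------------------------------
  -- the end: Lemma 9 at level `μ + (A + 1) > A`, then an invariant of valuation `≡ k₀ (mod r)`
  ------------------------------------------------------------------
  obtain ⟨z, u, hzk, hu, hzlev, hrel⟩ := hdesc (A + 1)
  obtain ⟨q, j, hqord, hqrel⟩ := exists_cocycle_eq_of_deep R F 𝔓 hH h𝔓 hs hA hzk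
    (lev := μ + (A + 1)) hzlev (by omega)
  rw [hr] at hqord
  have hz0 : z ≠ 0 := fun h => by
    have := not_mem_pow_succ_of_ordIdeal_eq 𝔓 hzk
    rw [h] at this; exact this (Submodule.zero_mem _)
  have hq0 : q ≠ 0 := fun h => by
    have := not_mem_pow_succ_of_ordIdeal_eq 𝔓 hqord
    rw [h] at this; exact this (Submodule.zero_mem _)
  have hu0 : u ≠ 0 := fun h => hu (h ▸ Submodule.zero_mem _)
  set θ := q * u with hθ
  have hθ0 : θ ≠ 0 := mul_ne_zero hq0 hu0
  have hsθ0 : s • θ ≠ 0 := fun h0 => hθ0 (by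
    have := congrArg (s⁻¹ • ·) h0
    simpa only [smul_smul, inv_mul_cancel, one_smul, smul_zero] using this)
  -- relation C: `c(z₀) = c(θ)`
  have hC : s • z₀ * θ = z₀ * s • θ := by
    have h : (s • z₀ * θ - z₀ * s • θ) * z = 0 := by
      have : (s • z₀ * θ - z₀ * s • θ) * z =
          (s • z₀ * (z * u)) * q - z₀ * (s • q * z) * s • u := by rw [hθ, smul_mul']; ring
      rw [this, hrel, hqrel, smul_mul']; ring
    rcases mul_eq_zero.mp h with h1 | h1
    · exact sub_eq_zero.mp h1
    · exact absurd h1 hz0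
  -- `t = z₀ θc` is `s`-invariant
  set θc := ∏ τ ∈ (Finset.univ : Finset F.fixingSubgroup).erase 1, (τ : L ≃ₐ[K] L) • θ with hθc
  set Nθ := ∏ τ : F.fixingSubgroup, (τ : L ≃ₐ[K] L) • θ with hNθ
  have hθθc : θ * θc = Nθ := mul_prod_erase_one_smul F.fixingSubgroup θ
  have hNθs : s • Nθ = Nθ := hprodfix σ₀ θ
  set t := z₀ * θc with ht
  have hts : s • t = t := by
    have h : (s • t - t) * (s • θ * θ) = 0 := by
      have h1 : s • t * s • θ = s • z₀ * Nθ := by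
        rw [ht, smul_mul', mul_assoc, ← smul_mul', mul_comm θc θ, hθθc, hNθs]
      have : (s • t - t) * (s • θ * θ) = (s • t * s • θ) * θ - z₀ * (θ * θc) * s • θ := by
        rw [ht]; ring
      rw [this, h1, hθθc, mul_assoc, mul_comm Nθ θ, ← mul_assoc, hC]; ring
    rcases mul_eq_zero.mp h with h1 | h1
    · exact sub_eq_zero.mp h1
    · exact absurd h1 (mul_ne_zero hsθ0 hθ0)
  have htfix : ∀ γ : F.fixingSubgroup, (γ : L ≃ₐ[K] L) • t = t := by
    have hpow : ∀ i : ℕ, (s ^ i) • t = t := fun i => by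
      induction i with
      | zero => rw [pow_zero, one_smul]
      | succ i ih => rw [pow_succ', mul_smul, ih, hts]
    intro γ
    obtain ⟨i, hi⟩ := e.surjective γ
    rw [← hi, he i, hpow]
  -- its valuation is `k₀ + (r-1) r j`, not a multiple of `r`
  have hθcord : ordIdeal 𝔓 θc = (((r - 1) * (r * j) : ℕ) : ℕ∞) := by
    have hθord : ordIdeal 𝔓 θ = ((r * j : ℕ) : ℕ∞) := by
      rw [hθ, ordIdeal_mul h𝔓, hqord, (ordIdeal_eq_zero_iff).mpr hu, add_zero]
    rw [hθc, ordIdeal_prod h𝔓, Finset.sum_congr rfl fun τ _ => by rw [hords τ θ, hθord],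
      Finset.sum_const, Finset.card_erase_of_mem (Finset.mem_univ _), Finset.card_univ, hrF,
      nsmul_eq_mul]
    push_cast; ring
  have htord : ordIdeal 𝔓 t = ((k₀ + (r - 1) * (r * j) : ℕ) : ℕ∞) := by
    rw [ht, ordIdeal_mul h𝔓, hz₀ord, hθcord]; push_cast; ring
  have hdvd := card_dvd_of_invariant_of_ordIdeal_eq R F 𝔓 h𝔓 hH htfix htord
  rw [hrF] at hdvd
  have hdvd' : r ∣ k₀ := by
    have h2 : r ∣ (r - 1) * (r * j) := Dvd.dvd.mul_left (dvd_mul_right r j) _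
    exact (Nat.dvd_add_left h2).mp hdvd
  exact absurd (Nat.le_of_dvd hk₀pos hdvd') (not_le.mpr hk₀r)

end Main

end Literature.NumberTheory.GaloisRepresentations

end
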